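import Literature.MathematicalPhysics.QuantumFieldTheory.BalabanImbrieJaffe1984to88.BIJ88W6PrimeSmall287

/-!
# `BalabanImbrieJaffe1984to88.BIJ88W6PrimeDerivSmall287` — T. Bałaban, J. Imbrie, A. Jaffe, *Effective action and cluster properties of
the abelian Higgs model*, Commun. Math. Phys. **114** (1988) 257–315 [BalabanImbrieJaffe1988], Sect. 5.6 p. 287 [PDF 31], the clause
*"with small covariant derivatives"* of the sentence *"The difference is w′₆, a small (O(e^{−cr(e_j)})), local kernel with small
covariant derivatives, and depending only locally on ũ_{k+1}, ũ"* — PROVED at operator level: `‖D w′₆‖` is small in the max-row-sum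
operator norm, for the `w′₆ = BIJ88Eq5612W6.w6prime` of record and any two-point covariant derivative `D` (`(DX)(b,·) = c_D(u_bX(b₊,·) −
X(b₋,·))`, the shape of `BIJ88Vj5610Operator.dMat`), from the printed inputs of Sect. 2 in kernel form INCLUDING their derivative
versions, p. 263 verbatim: *"Bounds analogous to (2.30), (2.31) hold for covariant derivatives and Hölder derivatives of G_{k,loc}(u) of
order less than two."*, and the smoothness of the cutoff `ζ″_k` ((2.29): *"a smooth function of x₁ − x₂"*) and of the convex combination
((2.27): *"The convex combination varies smoothly with (x₁+x₂)/2"*).  Companion of `BIJ88W6PrimeSmall287` (the size of `w′₆` itself).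

statement-level skeleton of published theorems with citation tags; proofs where landed; nothing here is a claim about the Yang–Mills mass gap

THE MECHANISM.  With the telescoping of `BIJ88W6PrimeSmall287` (`w′₆ = (T − T₃) + (T₃ − (ζ″G_ref)V_j(ζ″G′_ref)) + (ζ″G_ref)V_j(ζ″G′_ref −
G′_{loc}) + (ζ″G_ref − G_{loc})V_jG′_{loc}`), `D` acts on the LEFT factor of each piece only, through the two-point product rule (§1)
`D(Wη ⊙ X)(b,·) = W(b₋,·)(DX)(b,·) + c_Du_b[W(b₊,·) − W(b₋,·)]X(b₊,·)`: the first term is the same estimate as for `w′₆` with the row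
`G(x₁,·)` replaced by the row `(DG)(b,·)` (decay (2.30) and localization (2.31) *for covariant derivatives*, base point `b₋`; §2–§3 are
these rectangular versions), the second carries the smoothness constants `c_D|ζ″(b₊,·) − ζ″(b₋,·)| ≤ s_ζ`, `Σ_α c_D|ζ″λ_α(b₊,·) −
ζ″λ_α(b₋,·)| ≤ s` (small like `L/r(e_{j−1})`, never the bare `c_D = ζ⁻¹`) times rows already estimated in `BIJ88W6PrimeSmall287`.
RESULT (§5, `norm_D_w6prime_le`): `‖Dw′₆‖ ≤ K²v·{Λ₀(Cδ′ + C′δ + 4CC′E₂) + sC(2δ + 4CE₂) + 2C(C′ + s_ζC)E₁ + Λ₀δ(C′ + s_ζC) + Λ₀C(Λ₀δ′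
+ sδ)}` with `E₂ = e^{−(c/2)(R₂−1−ρ)}`, `E₁ = e^{−(c/2)(R₁−1−ρ)}` — every term carries `δ`, `δ′` (= `e^{−cr(e_j)}` in print) or an
`E` (thresholds on the scale `r(e_j)`): the printed smallness (`boundD_le_exp`).

HONEST SCOPE.  Inputs are hypotheses, each a printed item in kernel form: (2.30)/(2.31) for `G_j(□_α,·)` and for `DG_j(□_α,·)` (p. 263,
the sentence quoted above), with explicit constants `C, C′, c, δ, δ′`; the thresholds of (2.29) and the core geometry of (2.27) as in
`BIJ88W6PrimeSmall287` plus `R₂ ≥ 1` and `d(b₋,b₊), d(b₊,b₋) ≤ 1` (bonds join neighbours; distances in lattice units); the smoothness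
constants `s_ζ`, `s` of ζ″ and of ζ″λ_α ACROSS A BOND after multiplication by `c_D` (print: *"smooth"*, scale `r(e_{j−1})/(8L)`); the
`V_j` data.  Only the LEFT covariant derivative `Dw′₆` is treated (`w′₆D*` is the mirror image); Hölder derivatives are not.  Unit
`lit-balaban-p31` (literature-prover-lit-balaban-p31-g10-0), 2026-08-22.  NOT summit progress.
-/

namespace Literature.MathematicalPhysics.QuantumFieldTheory.BalabanImbrieJaffe1984to88.BIJ88W6PrimeDerivSmall287

open Literature.MathematicalPhysics.QuantumFieldTheory.Balaban1983to89
open BIJ88Vj5610Operator (dMat)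
open BIJ88Eq5612W6 (gLoc gLoc_apply w6prime)
open BIJ88W6PrimeSmall287 (rowSum_changeSet_le rowSum_gLoc_le rowSum_gLoc_sub_le)
open scoped BigOperators Matrix Matrix.Norms.Operator NNReal
open Matrix Finset

noncomputable section

/-! ## §0 Tools (as in `BIJ88W6PrimeSmall287`; private there) -/

section Tools

variable {m n p : Type*} [Fintype n] [Fintype p]

/-- kernel: one row sum is at most the `ℓ^∞`-operator norm. [folklore] -/
private theorem rowSum_le_norm [Fintype m] (B : Matrix m n ℂ) (k : m) : ∑ j, ‖B k j‖ ≤ ‖B‖ := by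
  rw [Matrix.linfty_opNorm_def]
  have h : (∑ j, ‖B k j‖₊) ≤ Finset.univ.sup fun i : m => ∑ j : n, ‖B i j‖₊ :=
    Finset.le_sup (f := fun i : m => ∑ j : n, ‖B i j‖₊) (Finset.mem_univ k)
  have h' := NNReal.coe_le_coe.mpr h
  push_cast at h'
  exact h'

/-- kernel: uniform row-sum bounds bound the norm. [folklore] -/
private theorem norm_le_of_rowSums [Fintype m] (A : Matrix m n ℂ) {r : ℝ} (hr : 0 ≤ r) (h : ∀ i, ∑ j, ‖A i j‖ ≤ r) :
    ‖A‖ ≤ r := by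
  rw [Matrix.linfty_opNorm_def]
  have key : (Finset.univ.sup fun i : m => ∑ j : n, ‖A i j‖₊) ≤ Real.toNNReal r := by
    refine Finset.sup_le fun i _ => ?_
    rw [← NNReal.coe_le_coe, Real.coe_toNNReal r hr]
    push_cast
    exact h i
  calc ((Finset.univ.sup fun i : m => ∑ j : n, ‖A i j‖₊ : ℝ≥0) : ℝ) ≤ (Real.toNNReal r : ℝ) := NNReal.coe_le_coe.mpr key
    _ = r := Real.coe_toNNReal r hr

/-- kernel: a row of a product, explicitly. [folklore] -/
private theorem rowSum_mul_le' (A : Matrix m n ℂ) (B : Matrix n p ℂ) (i : m) :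
    ∑ j, ‖(A * B) i j‖ ≤ ∑ k, ‖A i k‖ * ∑ j, ‖B k j‖ := by
  calc ∑ j, ‖(A * B) i j‖ ≤ ∑ j, ∑ k, ‖A i k‖ * ‖B k j‖ := by
        refine Finset.sum_le_sum fun j _ => ?_
        rw [Matrix.mul_apply]
        exact (norm_sum_le _ _).trans (Finset.sum_le_sum fun k _ => norm_mul_le _ _)
    _ = ∑ k, ‖A i k‖ * ∑ j, ‖B k j‖ := by
        rw [Finset.sum_comm]
        simp_rw [Finset.mul_sum]

/-- kernel: a row of a product is at most the row of the first factor times the norm of the second. [folklore] -/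
private theorem rowSum_mul_le (A : Matrix m n ℂ) (B : Matrix n p ℂ) (i : m) :
    ∑ j, ‖(A * B) i j‖ ≤ (∑ k, ‖A i k‖) * ‖B‖ := by
  calc ∑ j, ‖(A * B) i j‖ ≤ ∑ k, ‖A i k‖ * ∑ j, ‖B k j‖ := rowSum_mul_le' A B i
    _ ≤ ∑ k, ‖A i k‖ * ‖B‖ :=
        Finset.sum_le_sum fun k _ => mul_le_mul_of_nonneg_left (rowSum_le_norm B k) (norm_nonneg _)
    _ = (∑ k, ‖A i k‖) * ‖B‖ := by rw [Finset.sum_mul]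

/-- kernel: `e^{−ct} ≤ e^{−(c/2)t}` for `c, t ≥ 0`. [folklore] -/
private theorem exp_half_le {c t : ℝ} (hc : 0 ≤ c) (ht : 0 ≤ t) : Real.exp (-c * t) ≤ Real.exp (-(c / 2) * t) :=
  Real.exp_le_exp.mpr (by nlinarith)

/-- kernel: `e^{−ct} ≤ e^{−(c/2)R}e^{−(c/2)t}` for `c ≥ 0`, `t ≥ R`. [folklore] -/
private theorem exp_split_le {c t R : ℝ} (hc : 0 ≤ c) (hR : R ≤ t) :
    Real.exp (-c * t) ≤ Real.exp (-(c / 2) * R) * Real.exp (-(c / 2) * t) := by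
  rw [← Real.exp_add]
  exact Real.exp_le_exp.mpr (by nlinarith)

/-- kernel: `e^{−(c/2)R} ≤ e^{−(c/2)(R−t)}` for `c, t ≥ 0`. [folklore] -/
private theorem exp_mono_R {c R t : ℝ} (hc : 0 ≤ c) (ht : 0 ≤ t) :
    Real.exp (-(c / 2) * R) ≤ Real.exp (-(c / 2) * (R - t)) :=
  Real.exp_le_exp.mpr (by nlinarith)

end Tools

section Decay

variable {σ κ : Type*} [Fintype σ]

/-- kernel: `Σ_ye^{−c e(y)} ≤ Σ_ye^{−(c/2)e(y)} ≤ K` for a nonnegative profile `e`. [folklore] -/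
private theorem sum_exp_le' {e : σ → ℝ} {c K : ℝ} (hc : 0 ≤ c) (he : ∀ y, 0 ≤ e y)
    (hK : ∑ y, Real.exp (-(c / 2) * e y) ≤ K) : ∑ y, Real.exp (-c * e y) ≤ K :=
  (Finset.sum_le_sum fun y _ => exp_half_le hc (he y)).trans hK

/-- kernel: `Σ_ye^{−c d(x,y)} ≤ K`. [folklore] -/
private theorem sum_exp_le {d : σ → σ → ℝ} {c K : ℝ} (hc : 0 ≤ c) (hd : ∀ x y, 0 ≤ d x y)
    (hK : ∀ x, ∑ y, Real.exp (-(c / 2) * d x y) ≤ K) (x : σ) : ∑ y, Real.exp (-c * d x y) ≤ K :=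
  sum_exp_le' hc (hd x) (hK x)

/-- kernel: `‖G(x,y)‖ ≤ Ce^{−c d(x,y)}` gives rows `≤ CK`. [folklore] -/
private theorem rowSum_le_of_decay {d : σ → σ → ℝ} {c C K : ℝ} (hc : 0 ≤ c) (hC : 0 ≤ C) (hd : ∀ x y, 0 ≤ d x y)
    (hK : ∀ x, ∑ y, Real.exp (-(c / 2) * d x y) ≤ K) {G : Matrix σ σ ℂ}
    (hG : ∀ x y, ‖G x y‖ ≤ C * Real.exp (-c * d x y)) (x : σ) : ∑ y, ‖G x y‖ ≤ C * K := by
  calc ∑ y, ‖G x y‖ ≤ ∑ y, C * Real.exp (-c * d x y) := Finset.sum_le_sum fun y _ => hG x y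
    _ = C * ∑ y, Real.exp (-c * d x y) := by rw [Finset.mul_sum]
    _ ≤ C * K := by gcongr; exact sum_exp_le hc hd hK x

/-- kernel: and norm `≤ CK`. [folklore] -/
private theorem norm_le_of_decay {d : σ → σ → ℝ} {c C K : ℝ} (hc : 0 ≤ c) (hC : 0 ≤ C) (hK₀ : 0 ≤ K)
    (hd : ∀ x y, 0 ≤ d x y) (hK : ∀ x, ∑ y, Real.exp (-(c / 2) * d x y) ≤ K) {G : Matrix σ σ ℂ}
    (hG : ∀ x y, ‖G x y‖ ≤ C * Real.exp (-c * d x y)) : ‖G‖ ≤ C * K :=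
  norm_le_of_rowSums G (mul_nonneg hC hK₀) (rowSum_le_of_decay hc hC hd hK hG)

end Decay

/-! ## §1 The two-point covariant derivative and its product rule -/

section Deriv

variable {σ κ : Type*} [Fintype σ]

/-- **product rule** for a two-point covariant derivative `(DX)(b,y) = c_D(u_bX(b₊,y) − X(b₋,y))` (the shape of `D_u` on the lattice,
`BIJ88Vj5610Operator.dMat`; here an abstract hypothesis `hD`) acting on a weighted kernel `(W⊙X)(x,y) = W(x,y)X(x,y)` ((2.28): `G_{loc} =
ζ″G̃`): `D(W⊙X)(b,y) = W(b₋,y)(DX)(b,y) + c_Du_b[W(b₊,y) − W(b₋,y)]X(b₊,y)` — the derivative falls on the kernel or on the weight.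
[cite: BalabanImbrieJaffe1988, (2.28) p.263] -/
theorem deriv_weighted_apply {D : Matrix κ σ ℂ} {cD : ℂ} {u : κ → ℂ} {tgt src : κ → σ}
    (hD : ∀ (X : Matrix σ σ ℂ) (b : κ) (y : σ), (D * X) b y = cD * (u b * X (tgt b) y - X (src b) y))
    (W : σ → σ → ℂ) (X : Matrix σ σ ℂ) (b : κ) (y : σ) :
    (D * Matrix.of fun x y => W x y * X x y) b y
      = W (src b) y * (D * X) b y + cD * u b * (W (tgt b) y - W (src b) y) * X (tgt b) y := by
  rw [hD, hD, Matrix.of_apply, Matrix.of_apply]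
  ring

/-- kernel: the product rule at matrix level. [cite: BalabanImbrieJaffe1988, (2.28) p.263] -/
theorem deriv_weighted {D : Matrix κ σ ℂ} {cD : ℂ} {u : κ → ℂ} {tgt src : κ → σ}
    (hD : ∀ (X : Matrix σ σ ℂ) (b : κ) (y : σ), (D * X) b y = cD * (u b * X (tgt b) y - X (src b) y))
    (W : σ → σ → ℂ) (X : Matrix σ σ ℂ) :
    (D * Matrix.of fun x y => W x y * X x y)
      = (Matrix.of fun b y => W (src b) y * (D * X) b y)
        + Matrix.of fun b y => cD * u b * (W (tgt b) y - W (src b) y) * X (tgt b) y := by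
  ext b y
  rw [Matrix.add_apply, Matrix.of_apply, Matrix.of_apply]
  exact deriv_weighted_apply hD W X b y

/-- kernel: the concrete `D_u = dMat c u` of `BIJ88Vj5610Operator` has this two-point shape (`b₊ = b.tgt`, `b₋ = b.src`).
[cite: BalabanImbrieJaffe1988, (5.6.9) p.287] -/
theorem dMat_mul_apply {P : Params} {j : ℕ} (c : ℝ) (u : PBond P j → ℂ)
    (X : Matrix (Balaban1983to89.Site P j) (Balaban1983to89.Site P j) ℂ) (b : PBond P j) (y : Balaban1983to89.Site P j) :
    (dMat c u * X) b y = (c : ℂ) * (u b * X b.tgt y - X b.src y) := by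
  simp only [Matrix.mul_apply, dMat, Matrix.of_apply, sub_mul, Finset.sum_sub_distrib, mul_ite, mul_zero, ite_mul, zero_mul,
    Finset.sum_ite_eq', Finset.mem_univ, if_true]
  ring

end Deriv

/-! ## §2 *"changing the tails"* for a derivative row -/

section Tails

variable {σ κ : Type*} [Fintype σ]

/-- **changing the tails, derivative row**: the estimate `BIJ88W6PrimeSmall287.rowSum_tails_le` with the row `G_ref(x₁,·)` replaced by a
row `A(b,·)` of a bond-indexed kernel (`A = DG_ref`) decaying from the base point `b₋` ((2.30) *for covariant derivatives*, p. 263: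
`‖(DG_ref)(b,y)‖ ≤ C′e^{−c d(b₋,y)}`) and the cutoff weights taken at `b₋`: rows `≤ 2C′CK²v·e^{−(c/2)(R₁−ρ)}`.
[cite: BalabanImbrieJaffe1988, (2.30) p.263] -/
theorem rowSum_tails_rect_le {d : σ → σ → ℝ} {c C C' K v R₁ ρ : ℝ} (hc : 0 ≤ c) (hC : 0 ≤ C) (hC' : 0 ≤ C') (hv : 0 ≤ v)
    (hρ : 0 ≤ ρ) (hd : ∀ x y, 0 ≤ d x y) (htri : ∀ x y z, d x z ≤ d x y + d y z)
    (hK : ∀ x, ∑ y, Real.exp (-(c / 2) * d x y) ≤ K)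
    {Z : σ → σ → ℂ} (hZ1 : ∀ x y, ‖Z x y‖ ≤ 1) (hZR₁ : ∀ x y, d x y ≤ R₁ → Z x y = 1)
    (src : κ → σ) {A : Matrix κ σ ℂ} {Vj Gref' : Matrix σ σ ℂ}
    (hA : ∀ b y, ‖A b y‖ ≤ C' * Real.exp (-c * d (src b) y)) (hGr' : ∀ x y, ‖Gref' x y‖ ≤ C * Real.exp (-c * d x y))
    (hVj : ∀ y, ∑ z, ‖Vj y z‖ ≤ v) (hVρ : ∀ y z, Vj y z ≠ 0 → d y z ≤ ρ) (b : κ) :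
    ∑ x₂, ‖Z (src b) x₂ * (A * Vj * Gref') b x₂
        - ((Matrix.of fun b' y => Z (src b') y * A b' y) * Vj * Matrix.of fun x y => Z x y * Gref' x y) b x₂‖
      ≤ 2 * C' * C * K ^ 2 * v * Real.exp (-(c / 2) * (R₁ - ρ)) := by
  set x₁ := src b with hx₁def
  set E := Real.exp (-(c / 2) * (R₁ - ρ)) with hE
  have hK₀ : 0 ≤ K := (Finset.sum_nonneg fun y _ => (Real.exp_pos _).le).trans (hK x₁)
  have hentry : ∀ x₂, Z x₁ x₂ * (A * Vj * Gref') b x₂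
      - ((Matrix.of fun b' y => Z (src b') y * A b' y) * Vj * Matrix.of fun x y => Z x y * Gref' x y) b x₂
      = ∑ z, ∑ y, (Z x₁ x₂ - Z x₁ y * Z z x₂) * (A b y * Vj y z * Gref' z x₂) := by
    intro x₂
    simp only [Matrix.mul_apply, Matrix.of_apply, Finset.mul_sum, Finset.sum_mul, ← Finset.sum_sub_distrib, ← hx₁def]
    refine Finset.sum_congr rfl fun z _ => Finset.sum_congr rfl fun y _ => ?_
    ring
  have hterm : ∀ y z x₂, ‖(Z x₁ x₂ - Z x₁ y * Z z x₂) * (A b y * Vj y z * Gref' z x₂)‖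
      ≤ 2 * C' * C * E * (Real.exp (-(c / 2) * d x₁ y) * ‖Vj y z‖ * Real.exp (-(c / 2) * d z x₂)) := by
    intro y z x₂
    by_cases hV : Vj y z = 0
    · rw [hV]; simp
    have hyz : d y z ≤ ρ := hVρ y z hV
    by_cases hnear : d x₁ y ≤ R₁ ∧ d z x₂ ≤ R₁ ∧ d x₁ x₂ ≤ R₁
    · rw [hZR₁ _ _ hnear.1, hZR₁ _ _ hnear.2.1, hZR₁ _ _ hnear.2.2]
      simp only [mul_one, sub_self, zero_mul, norm_zero]
      positivity
    have hsum : R₁ - ρ ≤ d x₁ y + d z x₂ := by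
      by_cases h1 : d x₁ y ≤ R₁
      · by_cases h2 : d z x₂ ≤ R₁
        · have h3 : R₁ < d x₁ x₂ := lt_of_not_ge fun h => hnear ⟨h1, h2, h⟩
          have h4 : d x₁ x₂ ≤ d x₁ y + d y z + d z x₂ := (htri x₁ z x₂).trans (by linarith [htri x₁ y z])
          linarith
        · push Not at h2; linarith [hd x₁ y]
      · push Not at h1; linarith [hd z x₂]
    have hbr : ‖Z x₁ x₂ - Z x₁ y * Z z x₂‖ ≤ 2 := by
      calc ‖Z x₁ x₂ - Z x₁ y * Z z x₂‖ ≤ ‖Z x₁ x₂‖ + ‖Z x₁ y * Z z x₂‖ := norm_sub_le _ _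
        _ ≤ 1 + 1 * 1 := by rw [norm_mul]; gcongr <;> apply hZ1
        _ = 2 := by norm_num
    have hGG : ‖A b y‖ * ‖Gref' z x₂‖
        ≤ C' * C * E * (Real.exp (-(c / 2) * d x₁ y) * Real.exp (-(c / 2) * d z x₂)) := by
      calc ‖A b y‖ * ‖Gref' z x₂‖ ≤ (C' * Real.exp (-c * d x₁ y)) * (C * Real.exp (-c * d z x₂)) :=
            mul_le_mul (hA b y) (hGr' z x₂) (norm_nonneg _) (by positivity)
        _ = C' * C * Real.exp (-c * (d x₁ y + d z x₂)) := by rw [mul_add, Real.exp_add]; ring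
        _ ≤ C' * C * (Real.exp (-(c / 2) * (R₁ - ρ)) * Real.exp (-(c / 2) * (d x₁ y + d z x₂))) := by
            gcongr; exact exp_split_le hc hsum
        _ = C' * C * E * (Real.exp (-(c / 2) * d x₁ y) * Real.exp (-(c / 2) * d z x₂)) := by
            rw [hE, mul_add, Real.exp_add]; ring
    calc ‖(Z x₁ x₂ - Z x₁ y * Z z x₂) * (A b y * Vj y z * Gref' z x₂)‖
        = ‖Z x₁ x₂ - Z x₁ y * Z z x₂‖ * (‖A b y‖ * ‖Gref' z x₂‖ * ‖Vj y z‖) := by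
          simp only [norm_mul]; ring
      _ ≤ 2 * (C' * C * E * (Real.exp (-(c / 2) * d x₁ y) * Real.exp (-(c / 2) * d z x₂)) * ‖Vj y z‖) := by
          gcongr
      _ = _ := by ring
  calc ∑ x₂, ‖Z x₁ x₂ * (A * Vj * Gref') b x₂
          - ((Matrix.of fun b' y => Z (src b') y * A b' y) * Vj * Matrix.of fun x y => Z x y * Gref' x y) b x₂‖
      = ∑ x₂, ‖∑ z, ∑ y, (Z x₁ x₂ - Z x₁ y * Z z x₂) * (A b y * Vj y z * Gref' z x₂)‖ := by
        simp_rw [hentry]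
    _ ≤ ∑ x₂, ∑ z, ∑ y, 2 * C' * C * E * (Real.exp (-(c / 2) * d x₁ y) * ‖Vj y z‖ * Real.exp (-(c / 2) * d z x₂)) :=
        Finset.sum_le_sum fun x₂ _ => (norm_sum_le _ _).trans (Finset.sum_le_sum fun z _ =>
          (norm_sum_le _ _).trans (Finset.sum_le_sum fun y _ => hterm y z x₂))
    _ = ∑ y, ∑ z, ∑ x₂, 2 * C' * C * E * (Real.exp (-(c / 2) * d x₁ y) * ‖Vj y z‖ * Real.exp (-(c / 2) * d z x₂)) := by
        rw [Finset.sum_comm]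
        refine (Finset.sum_congr rfl fun z _ => Finset.sum_comm).trans ?_
        rw [Finset.sum_comm]
    _ = ∑ y, 2 * C' * C * E * Real.exp (-(c / 2) * d x₁ y) * ∑ z, ‖Vj y z‖ * ∑ x₂, Real.exp (-(c / 2) * d z x₂) := by
        refine Finset.sum_congr rfl fun y _ => ?_
        rw [Finset.mul_sum]
        refine Finset.sum_congr rfl fun z _ => ?_
        rw [Finset.mul_sum, Finset.mul_sum]
        refine Finset.sum_congr rfl fun x₂ _ => ?_
        ring
    _ ≤ ∑ y, 2 * C' * C * E * Real.exp (-(c / 2) * d x₁ y) * ∑ z, ‖Vj y z‖ * K := by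
        gcongr with y _ z _
        exact hK z
    _ = ∑ y, 2 * C' * C * E * Real.exp (-(c / 2) * d x₁ y) * ((∑ z, ‖Vj y z‖) * K) := by
        simp_rw [Finset.sum_mul]
    _ ≤ ∑ y, 2 * C' * C * E * Real.exp (-(c / 2) * d x₁ y) * (v * K) := by
        gcongr with y _
        exact hVj y
    _ = 2 * C' * C * E * (v * K) * ∑ y, Real.exp (-(c / 2) * d x₁ y) := by
        rw [Finset.mul_sum]; refine Finset.sum_congr rfl fun y _ => ?_; ring
    _ ≤ 2 * C' * C * E * (v * K) * K := by gcongr; exact hK x₁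
    _ = 2 * C' * C * K ^ 2 * v * E := by ring

/-- **changing the tails, the derivative on the cutoff**: the term in which `D` falls on `ζ″`, `c_Du_b[ζ″(b₊,·) − ζ″(b₋,·)]`, against
`G_refV_jG′_ref` at the row `b₊`: with the smoothness `c_D|ζ″(b₊,y) − ζ″(b₋,y)| ≤ s_ζ` ((2.29): ζ″ *"smooth"*), `|u_b| ≤ 1`, `d(b₋,b₊) ≤
1`, and since the difference of cutoffs vanishes unless `d(b₊,·) > R₁ − 1`, the decay pays: rows `≤ 2s_ζC²K²v·e^{−(c/2)(R₁−1−ρ)}`.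
[cite: BalabanImbrieJaffe1988, (2.29) p.263] -/
theorem rowSum_tailsDelta_le {d : σ → σ → ℝ} {c C K v R₁ ρ sZ : ℝ} (hc : 0 ≤ c) (hC : 0 ≤ C) (hv : 0 ≤ v) (hρ : 0 ≤ ρ)
    (hsZ0 : 0 ≤ sZ) (hd : ∀ x y, 0 ≤ d x y) (htri : ∀ x y z, d x z ≤ d x y + d y z)
    (hK : ∀ x, ∑ y, Real.exp (-(c / 2) * d x y) ≤ K)
    {Z : σ → σ → ℂ} (hZ1 : ∀ x y, ‖Z x y‖ ≤ 1) (hZR₁ : ∀ x y, d x y ≤ R₁ → Z x y = 1)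
    {tgt src : κ → σ} (hadj : ∀ b, d (src b) (tgt b) ≤ 1) {cD : ℂ} {u : κ → ℂ} (hu : ∀ b, ‖u b‖ ≤ 1)
    (hsZ : ∀ b y, ‖cD * (Z (tgt b) y - Z (src b) y)‖ ≤ sZ)
    {Gref Vj Gref' : Matrix σ σ ℂ}
    (hGr : ∀ x y, ‖Gref x y‖ ≤ C * Real.exp (-c * d x y)) (hGr' : ∀ x y, ‖Gref' x y‖ ≤ C * Real.exp (-c * d x y))
    (hVj : ∀ y, ∑ z, ‖Vj y z‖ ≤ v) (hVρ : ∀ y z, Vj y z ≠ 0 → d y z ≤ ρ) (b : κ) :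
    ∑ x₂, ‖cD * u b * (Z (tgt b) x₂ - Z (src b) x₂) * (Gref * Vj * Gref') (tgt b) x₂
        - ((Matrix.of fun b' y => cD * u b' * (Z (tgt b') y - Z (src b') y) * Gref (tgt b') y) * Vj
            * Matrix.of fun x y => Z x y * Gref' x y) b x₂‖
      ≤ 2 * sZ * C ^ 2 * K ^ 2 * v * Real.exp (-(c / 2) * (R₁ - 1 - ρ)) := by
  set x₁ := tgt b with hx₁def
  set x₀ := src b with hx₀def
  set E := Real.exp (-(c / 2) * (R₁ - 1 - ρ)) with hE
  have hK₀ : 0 ≤ K := (Finset.sum_nonneg fun y _ => (Real.exp_pos _).le).trans (hK x₁)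
  -- smoothness with the phase `u_b`
  have hsu : ∀ y, ‖cD * u b * (Z x₁ y - Z x₀ y)‖ ≤ sZ := fun y => by
    calc ‖cD * u b * (Z x₁ y - Z x₀ y)‖ = ‖u b‖ * ‖cD * (Z x₁ y - Z x₀ y)‖ := by simp only [norm_mul]; ring
      _ ≤ 1 * sZ := mul_le_mul (hu b) (hsZ b y) (norm_nonneg _) zero_le_one
      _ = sZ := one_mul _
  -- where the difference of cutoffs lives
  have hfar : ∀ y, Z x₁ y - Z x₀ y ≠ 0 → R₁ - 1 < d x₁ y := by
    intro y hne
    by_contra hle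
    push Not at hle
    have h1 : Z x₁ y = 1 := hZR₁ x₁ y (by linarith)
    have h0 : Z x₀ y = 1 := hZR₁ x₀ y (by linarith [htri x₀ x₁ y, hadj b])
    exact hne (by rw [h1, h0, sub_self])
  have hentry : ∀ x₂, cD * u b * (Z x₁ x₂ - Z x₀ x₂) * (Gref * Vj * Gref') x₁ x₂
      - ((Matrix.of fun b' y => cD * u b' * (Z (tgt b') y - Z (src b') y) * Gref (tgt b') y) * Vj
          * Matrix.of fun x y => Z x y * Gref' x y) b x₂
      = ∑ z, ∑ y, (cD * u b * (Z x₁ x₂ - Z x₀ x₂) - cD * u b * (Z x₁ y - Z x₀ y) * Z z x₂)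
          * (Gref x₁ y * Vj y z * Gref' z x₂) := by
    intro x₂
    simp only [Matrix.mul_apply, Matrix.of_apply, Finset.mul_sum, Finset.sum_mul, ← Finset.sum_sub_distrib, ← hx₁def, ← hx₀def]
    refine Finset.sum_congr rfl fun z _ => Finset.sum_congr rfl fun y _ => ?_
    ring
  have hterm : ∀ y z x₂, ‖(cD * u b * (Z x₁ x₂ - Z x₀ x₂) - cD * u b * (Z x₁ y - Z x₀ y) * Z z x₂)
      * (Gref x₁ y * Vj y z * Gref' z x₂)‖
      ≤ 2 * sZ * C ^ 2 * E * (Real.exp (-(c / 2) * d x₁ y) * ‖Vj y z‖ * Real.exp (-(c / 2) * d z x₂)) := by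
    intro y z x₂
    by_cases hV : Vj y z = 0
    · rw [hV]; simp
    have hyz : d y z ≤ ρ := hVρ y z hV
    have hP : ‖Gref x₁ y * Vj y z * Gref' z x₂‖ = ‖Gref x₁ y‖ * ‖Gref' z x₂‖ * ‖Vj y z‖ := by
      simp only [norm_mul]; ring
    -- (a) the derivative of the cutoff at `x₂`
    have ha : ‖cD * u b * (Z x₁ x₂ - Z x₀ x₂) * (Gref x₁ y * Vj y z * Gref' z x₂)‖
        ≤ sZ * C ^ 2 * E * (Real.exp (-(c / 2) * d x₁ y) * ‖Vj y z‖ * Real.exp (-(c / 2) * d z x₂)) := by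
      by_cases h0 : Z x₁ x₂ - Z x₀ x₂ = 0
      · rw [h0]; simp only [mul_zero, zero_mul, norm_zero]; positivity
      have hf : R₁ - 1 < d x₁ x₂ := hfar x₂ h0
      have hsum : R₁ - 1 - ρ ≤ d x₁ y + d z x₂ := by
        have h4 : d x₁ x₂ ≤ d x₁ y + d y z + d z x₂ := (htri x₁ z x₂).trans (by linarith [htri x₁ y z])
        linarith
      have hGG : ‖Gref x₁ y‖ * ‖Gref' z x₂‖
          ≤ C ^ 2 * E * (Real.exp (-(c / 2) * d x₁ y) * Real.exp (-(c / 2) * d z x₂)) := by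
        calc ‖Gref x₁ y‖ * ‖Gref' z x₂‖ ≤ (C * Real.exp (-c * d x₁ y)) * (C * Real.exp (-c * d z x₂)) :=
              mul_le_mul (hGr x₁ y) (hGr' z x₂) (norm_nonneg _) (by positivity)
          _ = C ^ 2 * Real.exp (-c * (d x₁ y + d z x₂)) := by rw [mul_add, Real.exp_add]; ring
          _ ≤ C ^ 2 * (Real.exp (-(c / 2) * (R₁ - 1 - ρ)) * Real.exp (-(c / 2) * (d x₁ y + d z x₂))) := by
              gcongr; exact exp_split_le hc hsum
          _ = C ^ 2 * E * (Real.exp (-(c / 2) * d x₁ y) * Real.exp (-(c / 2) * d z x₂)) := by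
              rw [hE, mul_add, Real.exp_add]; ring
      calc ‖cD * u b * (Z x₁ x₂ - Z x₀ x₂) * (Gref x₁ y * Vj y z * Gref' z x₂)‖
          = ‖cD * u b * (Z x₁ x₂ - Z x₀ x₂)‖ * (‖Gref x₁ y‖ * ‖Gref' z x₂‖ * ‖Vj y z‖) := by rw [norm_mul, hP]
        _ ≤ sZ * (C ^ 2 * E * (Real.exp (-(c / 2) * d x₁ y) * Real.exp (-(c / 2) * d z x₂)) * ‖Vj y z‖) := by
            gcongr; exact hsu x₂
        _ = _ := by ring
    -- (b) the derivative of the cutoff at `y`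
    have hb' : ‖cD * u b * (Z x₁ y - Z x₀ y) * Z z x₂ * (Gref x₁ y * Vj y z * Gref' z x₂)‖
        ≤ sZ * C ^ 2 * E * (Real.exp (-(c / 2) * d x₁ y) * ‖Vj y z‖ * Real.exp (-(c / 2) * d z x₂)) := by
      by_cases h0 : Z x₁ y - Z x₀ y = 0
      · rw [h0]; simp only [mul_zero, zero_mul, norm_zero]; positivity
      have hf : R₁ - 1 ≤ d x₁ y := (hfar y h0).le
      have hG1 : ‖Gref x₁ y‖ ≤ C * (E * Real.exp (-(c / 2) * d x₁ y)) := by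
        calc ‖Gref x₁ y‖ ≤ C * Real.exp (-c * d x₁ y) := hGr x₁ y
          _ ≤ C * (Real.exp (-(c / 2) * (R₁ - 1)) * Real.exp (-(c / 2) * d x₁ y)) := by
              gcongr; exact exp_split_le hc hf
          _ ≤ C * (E * Real.exp (-(c / 2) * d x₁ y)) := by gcongr; exact exp_mono_R hc hρ
      have hG2 : ‖Gref' z x₂‖ ≤ C * Real.exp (-(c / 2) * d z x₂) :=
        (hGr' z x₂).trans (mul_le_mul_of_nonneg_left (exp_half_le hc (hd z x₂)) hC)
      have hw : ‖cD * u b * (Z x₁ y - Z x₀ y) * Z z x₂‖ ≤ sZ * 1 := by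
        rw [norm_mul]; exact mul_le_mul (hsu y) (hZ1 z x₂) (norm_nonneg _) hsZ0
      calc ‖cD * u b * (Z x₁ y - Z x₀ y) * Z z x₂ * (Gref x₁ y * Vj y z * Gref' z x₂)‖
          = ‖cD * u b * (Z x₁ y - Z x₀ y) * Z z x₂‖ * (‖Gref x₁ y‖ * ‖Gref' z x₂‖ * ‖Vj y z‖) := by rw [norm_mul, hP]
        _ ≤ (sZ * 1) * ((C * (E * Real.exp (-(c / 2) * d x₁ y))) * (C * Real.exp (-(c / 2) * d z x₂)) * ‖Vj y z‖) := by
            gcongr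
        _ = _ := by ring
    calc ‖(cD * u b * (Z x₁ x₂ - Z x₀ x₂) - cD * u b * (Z x₁ y - Z x₀ y) * Z z x₂) * (Gref x₁ y * Vj y z * Gref' z x₂)‖
        = ‖cD * u b * (Z x₁ x₂ - Z x₀ x₂) * (Gref x₁ y * Vj y z * Gref' z x₂)
            - cD * u b * (Z x₁ y - Z x₀ y) * Z z x₂ * (Gref x₁ y * Vj y z * Gref' z x₂)‖ := by rw [sub_mul]
      _ ≤ ‖cD * u b * (Z x₁ x₂ - Z x₀ x₂) * (Gref x₁ y * Vj y z * Gref' z x₂)‖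
            + ‖cD * u b * (Z x₁ y - Z x₀ y) * Z z x₂ * (Gref x₁ y * Vj y z * Gref' z x₂)‖ := norm_sub_le _ _
      _ ≤ _ := by linarith [ha, hb']
  calc ∑ x₂, ‖cD * u b * (Z x₁ x₂ - Z x₀ x₂) * (Gref * Vj * Gref') x₁ x₂
          - ((Matrix.of fun b' y => cD * u b' * (Z (tgt b') y - Z (src b') y) * Gref (tgt b') y) * Vj
              * Matrix.of fun x y => Z x y * Gref' x y) b x₂‖
      = ∑ x₂, ‖∑ z, ∑ y, (cD * u b * (Z x₁ x₂ - Z x₀ x₂) - cD * u b * (Z x₁ y - Z x₀ y) * Z z x₂)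
          * (Gref x₁ y * Vj y z * Gref' z x₂)‖ := by
        simp_rw [hentry]
    _ ≤ ∑ x₂, ∑ z, ∑ y, 2 * sZ * C ^ 2 * E * (Real.exp (-(c / 2) * d x₁ y) * ‖Vj y z‖ * Real.exp (-(c / 2) * d z x₂)) :=
        Finset.sum_le_sum fun x₂ _ => (norm_sum_le _ _).trans (Finset.sum_le_sum fun z _ =>
          (norm_sum_le _ _).trans (Finset.sum_le_sum fun y _ => hterm y z x₂))
    _ = ∑ y, ∑ z, ∑ x₂, 2 * sZ * C ^ 2 * E * (Real.exp (-(c / 2) * d x₁ y) * ‖Vj y z‖ * Real.exp (-(c / 2) * d z x₂)) := by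
        rw [Finset.sum_comm]
        refine (Finset.sum_congr rfl fun z _ => Finset.sum_comm).trans ?_
        rw [Finset.sum_comm]
    _ = ∑ y, 2 * sZ * C ^ 2 * E * Real.exp (-(c / 2) * d x₁ y) * ∑ z, ‖Vj y z‖ * ∑ x₂, Real.exp (-(c / 2) * d z x₂) := by
        refine Finset.sum_congr rfl fun y _ => ?_
        rw [Finset.mul_sum]
        refine Finset.sum_congr rfl fun z _ => ?_
        rw [Finset.mul_sum, Finset.mul_sum]
        refine Finset.sum_congr rfl fun x₂ _ => ?_
        ring
    _ ≤ ∑ y, 2 * sZ * C ^ 2 * E * Real.exp (-(c / 2) * d x₁ y) * ∑ z, ‖Vj y z‖ * K := by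
        gcongr with y _ z _
        exact hK z
    _ = ∑ y, 2 * sZ * C ^ 2 * E * Real.exp (-(c / 2) * d x₁ y) * ((∑ z, ‖Vj y z‖) * K) := by
        simp_rw [Finset.sum_mul]
    _ ≤ ∑ y, 2 * sZ * C ^ 2 * E * Real.exp (-(c / 2) * d x₁ y) * (v * K) := by
        gcongr with y _
        exact hVj y
    _ = 2 * sZ * C ^ 2 * E * (v * K) * ∑ y, Real.exp (-(c / 2) * d x₁ y) := by
        rw [Finset.mul_sum]; refine Finset.sum_congr rfl fun y _ => ?_; ring
    _ ≤ 2 * sZ * C ^ 2 * E * (v * K) * K := by gcongr; exact hK x₁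
    _ = 2 * sZ * C ^ 2 * K ^ 2 * v * E := by ring

end Tails

/-! ## §3 *"changing the set □_α"* for a derivative row -/

section ChangeSet

variable {σ κ : Type*} [Fintype σ]

/-- **changing the set, one cube, derivative row**: `BIJ88W6PrimeSmall287.rowSum_changeSet_le` with the rows `G_α(x₁,·)`, `G_ref(x₁,·)`
replaced by rows `A_α(b,·)`, `A_ref(b,·)` of bond-indexed kernels (`A = DG`) decaying from the base point `x₁ = b₋` and close there
((2.30), (2.31) *for covariant derivatives*, p. 263: `‖A_ref(b,y)‖ ≤ C′e^{−c d(x₁,y)}`, `‖(A_α − A_ref)(b,y)‖ ≤ δ′e^{−c d(x₁,y)}`), the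
right factors as before: the row `b` of `A_αV_αG′_α − A_refV_jG′_ref` is at most `K²v(Cδ′ + C′δ + 4CC′e^{−(c/2)(R₂−ρ)})`.
[cite: BalabanImbrieJaffe1988, (2.31) p.263] -/
theorem rowSum_changeSet_rect_le {d : σ → σ → ℝ} {Core : σ → Prop} {c C C' δ δ' K v R₂ ρ : ℝ}
    (hc : 0 ≤ c) (hC : 0 ≤ C) (hC' : 0 ≤ C') (hδ : 0 ≤ δ) (hδ' : 0 ≤ δ') (hv : 0 ≤ v) (hρ : 0 ≤ ρ)
    (hd : ∀ x y, 0 ≤ d x y) (htri : ∀ x y z, d x z ≤ d x y + d y z)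
    (hK : ∀ x, ∑ y, Real.exp (-(c / 2) * d x y) ≤ K)
    {Aα Aref : Matrix κ σ ℂ} {Vα G'α Vj Gref' : Matrix σ σ ℂ}
    (hG'α : ∀ x y, ‖G'α x y‖ ≤ C * Real.exp (-c * d x y)) (hGr' : ∀ x y, ‖Gref' x y‖ ≤ C * Real.exp (-c * d x y))
    (hLG' : ∀ z y, Core z → ‖G'α z y - Gref' z y‖ ≤ δ * Real.exp (-c * d z y))
    (hVα : ∀ y, ∑ z, ‖Vα y z‖ ≤ v) (hVj : ∀ y, ∑ z, ‖Vj y z‖ ≤ v) (hVρ : ∀ y z, Vj y z ≠ 0 → d y z ≤ ρ)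
    (hVloc : ∀ y z, Core y → Vα y z = Vj y z)
    {x₁ : σ} {b : κ} (hAr : ∀ y, ‖Aref b y‖ ≤ C' * Real.exp (-c * d x₁ y))
    (hLA : ∀ y, ‖Aα b y - Aref b y‖ ≤ δ' * Real.exp (-c * d x₁ y)) (hx₁ : ∀ z, d x₁ z ≤ R₂ → Core z) :
    ∑ x₂, ‖(Aα * Vα * G'α - Aref * Vj * Gref') b x₂‖
      ≤ K ^ 2 * v * (C * δ' + C' * δ + 4 * C * C' * Real.exp (-(c / 2) * (R₂ - ρ))) := by
  set E := Real.exp (-(c / 2) * (R₂ - ρ)) with hE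
  have hK₀ : 0 ≤ K := (Finset.sum_nonneg fun y _ => (Real.exp_pos _).le).trans (hK x₁)
  have hdec : Aα * Vα * G'α - Aref * Vj * Gref'
      = (Aα - Aref) * (Vα * G'α) + Aref * ((Vα - Vj) * G'α) + Aref * Vj * (G'α - Gref') := by
    simp only [Matrix.sub_mul, Matrix.mul_sub, Matrix.mul_assoc]
    abel
  -- (i) `G_α → G_ref` at the row `x₁`
  have h1 : ∑ x₂, ‖((Aα - Aref) * (Vα * G'α)) b x₂‖ ≤ δ' * K * (v * (C * K)) := by
    have hA : ∑ y, ‖(Aα - Aref) b y‖ ≤ δ' * K := by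
      calc ∑ y, ‖(Aα - Aref) b y‖ ≤ ∑ y, δ' * Real.exp (-c * d x₁ y) :=
            Finset.sum_le_sum fun y _ => by rw [Matrix.sub_apply]; exact hLA y
        _ = δ' * ∑ y, Real.exp (-c * d x₁ y) := by rw [Finset.mul_sum]
        _ ≤ δ' * K := by gcongr; exact sum_exp_le hc hd hK x₁
    have hB : ‖Vα * G'α‖ ≤ v * (C * K) :=
      (norm_mul_le _ _).trans
        (mul_le_mul (norm_le_of_rowSums _ hv hVα) (norm_le_of_decay hc hC hK₀ hd hK hG'α) (norm_nonneg _) hv)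
    exact (rowSum_mul_le _ _ _).trans (mul_le_mul hA hB (norm_nonneg _) (by positivity))
  -- (ii) `V_α → V_j`: rows `y` in the core agree, rows outside are far from `x₁`
  have h2 : ∑ x₂, ‖(Aref * ((Vα - Vj) * G'α)) b x₂‖ ≤ C' * E * K * (2 * v * (C * K)) := by
    calc ∑ x₂, ‖(Aref * ((Vα - Vj) * G'α)) b x₂‖
        ≤ ∑ y, ‖Aref b y‖ * ∑ x₂, ‖((Vα - Vj) * G'α) y x₂‖ := rowSum_mul_le' _ _ _
      _ ≤ ∑ y, C' * E * Real.exp (-(c / 2) * d x₁ y) * (2 * v * (C * K)) := by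
          refine Finset.sum_le_sum fun y _ => ?_
          by_cases hy : Core y
          · have h0 : ∑ x₂, ‖((Vα - Vj) * G'α) y x₂‖ = 0 := by
              refine Finset.sum_eq_zero fun x₂ _ => ?_
              rw [norm_eq_zero, Matrix.mul_apply]
              exact Finset.sum_eq_zero fun z _ => by rw [Matrix.sub_apply, hVloc y z hy, sub_self, zero_mul]
            rw [h0, mul_zero]
            positivity
          · have hfar : R₂ ≤ d x₁ y := le_of_lt (lt_of_not_ge fun h => hy (hx₁ y h))
            have hGy : ‖Aref b y‖ ≤ C' * E * Real.exp (-(c / 2) * d x₁ y) := by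
              calc ‖Aref b y‖ ≤ C' * Real.exp (-c * d x₁ y) := hAr y
                _ ≤ C' * (Real.exp (-(c / 2) * R₂) * Real.exp (-(c / 2) * d x₁ y)) := by
                    gcongr; exact exp_split_le hc hfar
                _ ≤ C' * (E * Real.exp (-(c / 2) * d x₁ y)) := by gcongr; exact exp_mono_R hc hρ
                _ = _ := by ring
            have hrow : ∑ x₂, ‖((Vα - Vj) * G'α) y x₂‖ ≤ 2 * v * (C * K) := by
              have hz : ∑ z, ‖(Vα - Vj) y z‖ ≤ 2 * v := by
                calc ∑ z, ‖(Vα - Vj) y z‖ ≤ ∑ z, (‖Vα y z‖ + ‖Vj y z‖) :=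
                      Finset.sum_le_sum fun z _ => by rw [Matrix.sub_apply]; exact norm_sub_le _ _
                  _ ≤ 2 * v := by rw [Finset.sum_add_distrib]; linarith [hVα y, hVj y]
              exact (rowSum_mul_le _ _ _).trans
                (mul_le_mul hz (norm_le_of_decay hc hC hK₀ hd hK hG'α) (norm_nonneg _) (by positivity))
            exact mul_le_mul hGy hrow (by positivity) (by positivity)
      _ = C' * E * (2 * v * (C * K)) * ∑ y, Real.exp (-(c / 2) * d x₁ y) := by
          rw [Finset.mul_sum]; refine Finset.sum_congr rfl fun y _ => ?_; ring
      _ ≤ C' * E * (2 * v * (C * K)) * K := by gcongr; exact hK x₁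
      _ = _ := by ring
  -- (iii) `G′_α → G′_ref`: rows `z` in the core cost `δ`, rows outside are reached from `x₁` only over `> R₂ − ρ`
  have h3 : ∑ x₂, ‖(Aref * Vj * (G'α - Gref')) b x₂‖
      ≤ v * (C' * (δ * K) * K + C' * E * (2 * (C * K)) * K) := by
    have hrowα : ∀ z, ∑ x₂, ‖G'α z x₂‖ ≤ C * K := rowSum_le_of_decay hc hC hd hK hG'α
    have hrowr : ∀ z, ∑ x₂, ‖Gref' z x₂‖ ≤ C * K := rowSum_le_of_decay hc hC hd hK hGr'
    calc ∑ x₂, ‖(Aref * Vj * (G'α - Gref')) b x₂‖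
        ≤ ∑ z, ‖(Aref * Vj) b z‖ * ∑ x₂, ‖(G'α - Gref') z x₂‖ := rowSum_mul_le' _ _ _
      _ ≤ ∑ z, ∑ y, ‖Aref b y‖ * ‖Vj y z‖ * ∑ x₂, ‖(G'α - Gref') z x₂‖ := by
          refine Finset.sum_le_sum fun z _ => ?_
          rw [← Finset.sum_mul]
          refine mul_le_mul_of_nonneg_right ?_ (by positivity)
          rw [Matrix.mul_apply]
          exact (norm_sum_le _ _).trans (Finset.sum_le_sum fun y _ => norm_mul_le _ _)
      _ ≤ ∑ z, ∑ y, ‖Vj y z‖ * (C' * (δ * K) * Real.exp (-c * d x₁ y)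
              + C' * E * (2 * (C * K)) * Real.exp (-(c / 2) * d x₁ y)) := by
          refine Finset.sum_le_sum fun z _ => Finset.sum_le_sum fun y _ => ?_
          by_cases hV0 : Vj y z = 0
          · rw [hV0, norm_zero, mul_zero, zero_mul, zero_mul]
          have hyz : d y z ≤ ρ := hVρ y z hV0
          by_cases hz : Core z
          · have hrow : ∑ x₂, ‖(G'α - Gref') z x₂‖ ≤ δ * K := by
              calc ∑ x₂, ‖(G'α - Gref') z x₂‖ ≤ ∑ x₂, δ * Real.exp (-c * d z x₂) :=
                    Finset.sum_le_sum fun x₂ _ => by rw [Matrix.sub_apply]; exact hLG' z x₂ hz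
                _ = δ * ∑ x₂, Real.exp (-c * d z x₂) := by rw [Finset.mul_sum]
                _ ≤ δ * K := by gcongr; exact sum_exp_le hc hd hK z
            have hnn : 0 ≤ ‖Vj y z‖ * (C' * E * (2 * (C * K)) * Real.exp (-(c / 2) * d x₁ y)) := by positivity
            calc ‖Aref b y‖ * ‖Vj y z‖ * ∑ x₂, ‖(G'α - Gref') z x₂‖
                ≤ (C' * Real.exp (-c * d x₁ y)) * ‖Vj y z‖ * (δ * K) := by gcongr; exact hAr y
              _ = ‖Vj y z‖ * (C' * (δ * K) * Real.exp (-c * d x₁ y)) := by ring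
              _ ≤ _ := by rw [mul_add]; linarith
          · have hfarz : R₂ < d x₁ z := lt_of_not_ge fun h => hz (hx₁ z h)
            have hfary : R₂ - ρ ≤ d x₁ y := by linarith [htri x₁ y z]
            have hGy : ‖Aref b y‖ ≤ C' * (E * Real.exp (-(c / 2) * d x₁ y)) :=
              (hAr y).trans (by gcongr; exact exp_split_le hc hfary)
            have hrow : ∑ x₂, ‖(G'α - Gref') z x₂‖ ≤ 2 * (C * K) := by
              calc ∑ x₂, ‖(G'α - Gref') z x₂‖ ≤ ∑ x₂, (‖G'α z x₂‖ + ‖Gref' z x₂‖) :=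
                    Finset.sum_le_sum fun x₂ _ => by rw [Matrix.sub_apply]; exact norm_sub_le _ _
                _ ≤ 2 * (C * K) := by rw [Finset.sum_add_distrib]; linarith [hrowα z, hrowr z]
            have hnn : 0 ≤ ‖Vj y z‖ * (C' * (δ * K) * Real.exp (-c * d x₁ y)) := by positivity
            calc ‖Aref b y‖ * ‖Vj y z‖ * ∑ x₂, ‖(G'α - Gref') z x₂‖
                ≤ (C' * (E * Real.exp (-(c / 2) * d x₁ y))) * ‖Vj y z‖ * (2 * (C * K)) := by gcongr
              _ = ‖Vj y z‖ * (C' * E * (2 * (C * K)) * Real.exp (-(c / 2) * d x₁ y)) := by ring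
              _ ≤ _ := by rw [mul_add]; linarith
      _ = ∑ y, (∑ z, ‖Vj y z‖) * (C' * (δ * K) * Real.exp (-c * d x₁ y)
              + C' * E * (2 * (C * K)) * Real.exp (-(c / 2) * d x₁ y)) := by
          rw [Finset.sum_comm]
          simp_rw [Finset.sum_mul]
      _ ≤ ∑ y, v * (C' * (δ * K) * Real.exp (-c * d x₁ y) + C' * E * (2 * (C * K)) * Real.exp (-(c / 2) * d x₁ y)) :=
          Finset.sum_le_sum fun y _ => mul_le_mul_of_nonneg_right (hVj y) (by positivity)
      _ = v * (C' * (δ * K) * ∑ y, Real.exp (-c * d x₁ y) + C' * E * (2 * (C * K)) * ∑ y, Real.exp (-(c / 2) * d x₁ y)) := by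
          rw [← Finset.mul_sum, Finset.sum_add_distrib, Finset.mul_sum, Finset.mul_sum]
      _ ≤ v * (C' * (δ * K) * K + C' * E * (2 * (C * K)) * K) := by
          gcongr
          · exact sum_exp_le hc hd hK x₁
          · exact hK x₁
  -- assembling
  calc ∑ x₂, ‖(Aα * Vα * G'α - Aref * Vj * Gref') b x₂‖
      = ∑ x₂, ‖((Aα - Aref) * (Vα * G'α)) b x₂ + (Aref * ((Vα - Vj) * G'α)) b x₂
          + (Aref * Vj * (G'α - Gref')) b x₂‖ := by
        simp_rw [hdec, Matrix.add_apply]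
    _ ≤ ∑ x₂, (‖((Aα - Aref) * (Vα * G'α)) b x₂‖ + ‖(Aref * ((Vα - Vj) * G'α)) b x₂‖
          + ‖(Aref * Vj * (G'α - Gref')) b x₂‖) :=
        Finset.sum_le_sum fun x₂ _ => norm_add₃_le
    _ = ∑ x₂, ‖((Aα - Aref) * (Vα * G'α)) b x₂‖ + ∑ x₂, ‖(Aref * ((Vα - Vj) * G'α)) b x₂‖
          + ∑ x₂, ‖(Aref * Vj * (G'α - Gref')) b x₂‖ := by
        rw [Finset.sum_add_distrib, Finset.sum_add_distrib]
    _ ≤ δ' * K * (v * (C * K)) + C' * E * K * (2 * v * (C * K)) + v * (C' * (δ * K) * K + C' * E * (2 * (C * K)) * K) :=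
        add_le_add (add_le_add h1 h2) h3
    _ = K ^ 2 * v * (C * δ' + C' * δ + 4 * C * C' * E) := by ring


end ChangeSet

/-! ## §4 The derivative of the localized kernels: `D(ζ″G_ref)` and `D(ζ″G_ref − G_{loc})` -/

section DLoc

variable {σ ι κ : Type*} [Fintype σ] [Fintype ι]

/-- **`D(ζ″G_ref)` has bounded rows**: by the product rule, `D(ζ″G_ref)(b,·) = ζ″(b₋,·)(DG_ref)(b,·) + c_Du_b[ζ″(b₊,·) − ζ″(b₋,·)]G_ref(b₊,·)`,
so (2.30) for `DG_ref` (constant `C′`) and for `G_ref` (constant `C`) with the smoothness `c_D|ζ″(b₊,·) − ζ″(b₋,·)| ≤ s_ζ` give rows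
`≤ (C′ + s_ζC)K`. [cite: BalabanImbrieJaffe1988, (2.30) p.263] -/
theorem rowSum_D_ZG_le {d : σ → σ → ℝ} {c C C' K sZ : ℝ} (hc : 0 ≤ c) (hC' : 0 ≤ C') (hsZ0 : 0 ≤ sZ)
    (hd : ∀ x y, 0 ≤ d x y) (hK : ∀ x, ∑ y, Real.exp (-(c / 2) * d x y) ≤ K)
    {Z : σ → σ → ℂ} (hZ1 : ∀ x y, ‖Z x y‖ ≤ 1)
    {D : Matrix κ σ ℂ} {cD : ℂ} {u : κ → ℂ} {tgt src : κ → σ}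
    (hD : ∀ (X : Matrix σ σ ℂ) (b : κ) (y : σ), (D * X) b y = cD * (u b * X (tgt b) y - X (src b) y))
    (hu : ∀ b, ‖u b‖ ≤ 1) (hsZ : ∀ b y, ‖cD * (Z (tgt b) y - Z (src b) y)‖ ≤ sZ)
    {Gref : Matrix σ σ ℂ} (hGr : ∀ x y, ‖Gref x y‖ ≤ C * Real.exp (-c * d x y))
    (hDGr : ∀ b y, ‖(D * Gref) b y‖ ≤ C' * Real.exp (-c * d (src b) y)) (b : κ) :
    ∑ y, ‖(D * Matrix.of fun x y => Z x y * Gref x y) b y‖ ≤ (C' + sZ * C) * K := by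
  have hsu : ∀ y, ‖cD * u b * (Z (tgt b) y - Z (src b) y)‖ ≤ sZ := fun y => by
    calc ‖cD * u b * (Z (tgt b) y - Z (src b) y)‖ = ‖u b‖ * ‖cD * (Z (tgt b) y - Z (src b) y)‖ := by
          simp only [norm_mul]; ring
      _ ≤ 1 * sZ := mul_le_mul (hu b) (hsZ b y) (norm_nonneg _) zero_le_one
      _ = sZ := one_mul _
  calc ∑ y, ‖(D * Matrix.of fun x y => Z x y * Gref x y) b y‖
      = ∑ y, ‖Z (src b) y * (D * Gref) b y + cD * u b * (Z (tgt b) y - Z (src b) y) * Gref (tgt b) y‖ := by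
        simp_rw [deriv_weighted_apply hD]
    _ ≤ ∑ y, (1 * (C' * Real.exp (-c * d (src b) y)) + sZ * (C * Real.exp (-c * d (tgt b) y))) :=
        Finset.sum_le_sum fun y _ => (norm_add_le _ _).trans (add_le_add
          (by rw [norm_mul]; exact mul_le_mul (hZ1 _ _) (hDGr b y) (norm_nonneg _) zero_le_one)
          (by rw [norm_mul]; exact mul_le_mul (hsu y) (hGr _ _) (norm_nonneg _) hsZ0))
    _ = C' * ∑ y, Real.exp (-c * d (src b) y) + sZ * (C * ∑ y, Real.exp (-c * d (tgt b) y)) := by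
        rw [Finset.sum_add_distrib, ← Finset.mul_sum, ← Finset.mul_sum, ← Finset.mul_sum, ← Finset.mul_sum, one_mul]
    _ ≤ C' * K + sZ * (C * K) := by
        have hC : 0 ≤ C := by
          have h := hGr (src b) (src b)
          have hpos : 0 < Real.exp (-c * d (src b) (src b)) := Real.exp_pos _
          nlinarith [norm_nonneg (Gref (src b) (src b))]
        gcongr
        · exact sum_exp_le hc hd hK _
        · exact sum_exp_le hc hd hK _
    _ = (C' + sZ * C) * K := by ring

/-- **`D(ζ″G_ref − G_{loc})` has small rows** — *"changing the set"* under the derivative: with `Σ_αλ_α = 1`, `ζ″G_ref − G_{loc} =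
Σ_α ζ″λ_α(G_ref − G_α)`, and by the product rule each term is `ζ″λ_α(b₋,·)(DG_ref − DG_α)(b,·)` (localization (2.31) *for covariant
derivatives*, constant `δ′`, valid since `b₋`, `b₊` lie in the core of `□_α` whenever `ζ″λ_α(b₋,·) ≠ 0`) plus `c_Du_b[ζ″λ_α(b₊,·) −
ζ″λ_α(b₋,·)](G_ref − G_α)(b₊,·)` (smoothness `Σ_α c_D|ζ″λ_α(b₊,·) − ζ″λ_α(b₋,·)| ≤ s` times the localization (2.31), constant `δ`): rows
`≤ (Λ₀δ′ + sδ)K`. [cite: BalabanImbrieJaffe1988, (2.31) p.263] -/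
theorem rowSum_D_gLoc_sub_le {d : σ → σ → ℝ} {Core : ι → σ → Prop} {c δ δ' K Λ₀ s R₂ : ℝ} (hc : 0 ≤ c) (hδ : 0 ≤ δ)
    (hδ' : 0 ≤ δ') (hR₂ : 1 ≤ R₂) (hd : ∀ x y, 0 ≤ d x y) (hdd : ∀ x, d x x = 0)
    (hK : ∀ x, ∑ y, Real.exp (-(c / 2) * d x y) ≤ K)
    {Z : σ → σ → ℂ} {Λ : ι → σ → σ → ℂ} {μ : ι → σ → ℝ} (hμ0 : ∀ α x, 0 ≤ μ α x)
    (hΛμ : ∀ α x y, ‖Z x y * Λ α x y‖ ≤ μ α x) (hμ : ∀ x, ∑ α, μ α x ≤ Λ₀) (hΛ1 : ∀ x y, ∑ α, Λ α x y = 1)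
    (hcore : ∀ α x y, Z x y * Λ α x y ≠ 0 → ∀ z, d x z ≤ R₂ → Core α z)
    {tgt src : κ → σ} (hadj : ∀ b, d (src b) (tgt b) ≤ 1)
    {D : Matrix κ σ ℂ} {cD : ℂ} {u : κ → ℂ}
    (hD : ∀ (X : Matrix σ σ ℂ) (b : κ) (y : σ), (D * X) b y = cD * (u b * X (tgt b) y - X (src b) y))
    (hu : ∀ b, ‖u b‖ ≤ 1) {ν : ι → κ → ℝ} (hν0 : ∀ α b, 0 ≤ ν α b)
    (hνW : ∀ α b y, ‖cD * (Z (tgt b) y * Λ α (tgt b) y - Z (src b) y * Λ α (src b) y)‖ ≤ ν α b)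
    (hν : ∀ b, ∑ α, ν α b ≤ s)
    {G : ι → Matrix σ σ ℂ} {Gref : Matrix σ σ ℂ}
    (hLG : ∀ α z y, Core α z → ‖G α z y - Gref z y‖ ≤ δ * Real.exp (-c * d z y))
    (hDL : ∀ α b y, Core α (src b) → Core α (tgt b) → ‖(D * G α) b y - (D * Gref) b y‖ ≤ δ' * Real.exp (-c * d (src b) y))
    (b : κ) :
    ∑ y, ‖(D * ((Matrix.of fun x y => Z x y * Gref x y) - gLoc Z Λ G)) b y‖ ≤ (Λ₀ * δ' + s * δ) * K := by
  -- the entries of `ζ″G_ref − G_loc`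
  have hM : ∀ x y, ((Matrix.of fun x y => Z x y * Gref x y) - gLoc Z Λ G) x y
      = ∑ α, (Z x y * Λ α x y) * (Gref x y - G α x y) := by
    intro x y
    have h1 : Z x y * Gref x y = ∑ α, Z x y * Λ α x y * Gref x y := by
      rw [← Finset.sum_mul, ← Finset.mul_sum, hΛ1 x y, mul_one]
    rw [Matrix.sub_apply, Matrix.of_apply, gLoc_apply, Finset.mul_sum, h1, ← Finset.sum_sub_distrib]
    refine Finset.sum_congr rfl fun α _ => ?_
    ring
  -- the product rule, term by term
  have hentry : ∀ y, (D * ((Matrix.of fun x y => Z x y * Gref x y) - gLoc Z Λ G)) b y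
      = ∑ α, ((Z (src b) y * Λ α (src b) y) * ((D * Gref) b y - (D * G α) b y)
          + cD * u b * (Z (tgt b) y * Λ α (tgt b) y - Z (src b) y * Λ α (src b) y) * (Gref (tgt b) y - G α (tgt b) y)) := by
    intro y
    rw [hD, hM, hM, Finset.mul_sum, ← Finset.sum_sub_distrib, Finset.mul_sum]
    refine Finset.sum_congr rfl fun α _ => ?_
    rw [hD, hD]
    ring
  -- cores along the bond
  have hcoreB : ∀ α y, Z (src b) y * Λ α (src b) y ≠ 0 → Core α (src b) ∧ Core α (tgt b) := fun α y h0 =>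
    ⟨hcore α _ y h0 _ (by rw [hdd]; linarith), hcore α _ y h0 _ (by linarith [hadj b])⟩
  have hcoreT : ∀ α y, Z (tgt b) y * Λ α (tgt b) y - Z (src b) y * Λ α (src b) y ≠ 0 → Core α (tgt b) := by
    intro α y hne
    by_cases h1 : Z (tgt b) y * Λ α (tgt b) y = 0
    · have h0 : Z (src b) y * Λ α (src b) y ≠ 0 := fun h => hne (by rw [h1, h, sub_self])
      exact (hcoreB α y h0).2
    · exact hcore α _ y h1 _ (by rw [hdd]; linarith)
  have hterm : ∀ y α, ‖(Z (src b) y * Λ α (src b) y) * ((D * Gref) b y - (D * G α) b y)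
      + cD * u b * (Z (tgt b) y * Λ α (tgt b) y - Z (src b) y * Λ α (src b) y) * (Gref (tgt b) y - G α (tgt b) y)‖
      ≤ μ α (src b) * (δ' * Real.exp (-c * d (src b) y)) + ν α b * (δ * Real.exp (-c * d (tgt b) y)) := by
    intro y α
    refine (norm_add_le _ _).trans (add_le_add ?_ ?_)
    · by_cases h0 : Z (src b) y * Λ α (src b) y = 0
      · rw [h0, zero_mul, norm_zero]; exact mul_nonneg (hμ0 α _) (by positivity)
      · obtain ⟨hCs, hCt⟩ := hcoreB α y h0
        rw [norm_mul, norm_sub_rev]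
        exact mul_le_mul (hΛμ α _ y) (hDL α b y hCs hCt) (norm_nonneg _) (hμ0 α _)
    · by_cases h0 : Z (tgt b) y * Λ α (tgt b) y - Z (src b) y * Λ α (src b) y = 0
      · rw [h0, mul_zero, zero_mul, norm_zero]; exact mul_nonneg (hν0 α b) (by positivity)
      · have hCt := hcoreT α y h0
        have hw : ‖cD * u b * (Z (tgt b) y * Λ α (tgt b) y - Z (src b) y * Λ α (src b) y)‖ ≤ ν α b := by
          calc ‖cD * u b * (Z (tgt b) y * Λ α (tgt b) y - Z (src b) y * Λ α (src b) y)‖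
              = ‖u b‖ * ‖cD * (Z (tgt b) y * Λ α (tgt b) y - Z (src b) y * Λ α (src b) y)‖ := by
                simp only [norm_mul]; ring
            _ ≤ 1 * ν α b := mul_le_mul (hu b) (hνW α b y) (norm_nonneg _) zero_le_one
            _ = ν α b := one_mul _
        rw [norm_mul, norm_sub_rev (Gref _ _)]
        exact mul_le_mul hw (hLG α _ y hCt) (norm_nonneg _) (hν0 α b)
  calc ∑ y, ‖(D * ((Matrix.of fun x y => Z x y * Gref x y) - gLoc Z Λ G)) b y‖
      = ∑ y, ‖∑ α, ((Z (src b) y * Λ α (src b) y) * ((D * Gref) b y - (D * G α) b y)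
          + cD * u b * (Z (tgt b) y * Λ α (tgt b) y - Z (src b) y * Λ α (src b) y) * (Gref (tgt b) y - G α (tgt b) y))‖ := by
        simp_rw [hentry]
    _ ≤ ∑ y, ∑ α, (μ α (src b) * (δ' * Real.exp (-c * d (src b) y)) + ν α b * (δ * Real.exp (-c * d (tgt b) y))) :=
        Finset.sum_le_sum fun y _ => (norm_sum_le _ _).trans (Finset.sum_le_sum fun α _ => hterm y α)
    _ = (∑ α, μ α (src b)) * (δ' * ∑ y, Real.exp (-c * d (src b) y))
          + (∑ α, ν α b) * (δ * ∑ y, Real.exp (-c * d (tgt b) y)) := by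
        rw [Finset.sum_comm, Finset.sum_mul, Finset.sum_mul, ← Finset.sum_add_distrib]
        refine Finset.sum_congr rfl fun α _ => ?_
        rw [Finset.mul_sum, Finset.mul_sum, Finset.mul_sum, Finset.mul_sum, ← Finset.sum_add_distrib]
    _ ≤ Λ₀ * (δ' * K) + s * (δ * K) := by
        have h1 : δ' * ∑ y, Real.exp (-c * d (src b) y) ≤ δ' * K := by gcongr; exact sum_exp_le hc hd hK _
        have h2 : δ * ∑ y, Real.exp (-c * d (tgt b) y) ≤ δ * K := by gcongr; exact sum_exp_le hc hd hK _
        have h1' : 0 ≤ δ' * ∑ y, Real.exp (-c * d (src b) y) := by positivity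
        have h2' : 0 ≤ δ * ∑ y, Real.exp (-c * d (tgt b) y) := by positivity
        have hμs : 0 ≤ ∑ α, μ α (src b) := Finset.sum_nonneg fun α _ => hμ0 α _
        have hνs : 0 ≤ ∑ α, ν α b := Finset.sum_nonneg fun α _ => hν0 α _
        exact add_le_add
          ((mul_le_mul_of_nonneg_right (hμ (src b)) h1').trans (mul_le_mul_of_nonneg_left h1 (hμs.trans (hμ _))))
          ((mul_le_mul_of_nonneg_right (hν b) h2').trans (mul_le_mul_of_nonneg_left h2 (hνs.trans (hν _))))
    _ = (Λ₀ * δ' + s * δ) * K := by ring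

end DLoc

/-! ## §5 The size of `Dw′₆`: *"with small covariant derivatives"* -/

section Main

variable {σ ι κ : Type*} [Fintype σ] [Fintype ι]

/-- **`D(T − T₃)`, rows** — the derivative of the *"changing the set"* piece: by the product rule each cube contributes
`ζ″λ_α(b₋,·)·D(G_αV_αG′_α − G_refV_jG′_ref)(b,·)` (the rectangular `rowSum_changeSet_rect_le` at base `b₋`, multiplicity `Λ₀`) and
`c_Du_b[ζ″λ_α(b₊,·) − ζ″λ_α(b₋,·)]·(G_αV_αG′_α − G_refV_jG′_ref)(b₊,·)` (smoothness `s` times `BIJ88W6PrimeSmall287.rowSum_changeSet_le` at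
`b₊`, radius `R₂ − 1`): rows `≤ Λ₀K²v(Cδ′ + C′δ + 4CC′E₂) + sCK²v(2δ + 4CE₂)`, `E₂ = e^{−(c/2)(R₂−1−ρ)}`.
[cite: BalabanImbrieJaffe1988, (5.6.12) p.287] -/
theorem rowSum_D_TsubT3_le {d : σ → σ → ℝ} {Core : ι → σ → Prop} {c C C' δ δ' K v Λ₀ s R₂ ρ : ℝ}
    (hc : 0 ≤ c) (hC : 0 ≤ C) (hC' : 0 ≤ C') (hδ : 0 ≤ δ) (hδ' : 0 ≤ δ') (hv : 0 ≤ v) (hρ : 0 ≤ ρ) (hR₂ : 1 ≤ R₂)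
    (hd : ∀ x y, 0 ≤ d x y) (hdd : ∀ x, d x x = 0) (htri : ∀ x y z, d x z ≤ d x y + d y z)
    (hK : ∀ x, ∑ y, Real.exp (-(c / 2) * d x y) ≤ K)
    {Z : σ → σ → ℂ} {Λ : ι → σ → σ → ℂ} {μ : ι → σ → ℝ} (hμ0 : ∀ α x, 0 ≤ μ α x)
    (hΛμ : ∀ α x y, ‖Z x y * Λ α x y‖ ≤ μ α x) (hμ : ∀ x, ∑ α, μ α x ≤ Λ₀) (hΛ1 : ∀ x y, ∑ α, Λ α x y = 1)
    (hcore : ∀ α x y, Z x y * Λ α x y ≠ 0 → ∀ z, d x z ≤ R₂ → Core α z)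
    {tgt src : κ → σ} (hadj : ∀ b, d (src b) (tgt b) ≤ 1)
    {D : Matrix κ σ ℂ} {cD : ℂ} {u : κ → ℂ}
    (hD : ∀ (X : Matrix σ σ ℂ) (b : κ) (y : σ), (D * X) b y = cD * (u b * X (tgt b) y - X (src b) y))
    (hu : ∀ b, ‖u b‖ ≤ 1) {ν : ι → κ → ℝ} (hν0 : ∀ α b, 0 ≤ ν α b)
    (hνW : ∀ α b y, ‖cD * (Z (tgt b) y * Λ α (tgt b) y - Z (src b) y * Λ α (src b) y)‖ ≤ ν α b)
    (hν : ∀ b, ∑ α, ν α b ≤ s)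
    {G V G' : ι → Matrix σ σ ℂ} {Gref Vj Gref' : Matrix σ σ ℂ}
    (hG' : ∀ α x y, ‖G' α x y‖ ≤ C * Real.exp (-c * d x y)) (hGr : ∀ x y, ‖Gref x y‖ ≤ C * Real.exp (-c * d x y))
    (hGr' : ∀ x y, ‖Gref' x y‖ ≤ C * Real.exp (-c * d x y))
    (hLG : ∀ α z y, Core α z → ‖G α z y - Gref z y‖ ≤ δ * Real.exp (-c * d z y))
    (hLG' : ∀ α z y, Core α z → ‖G' α z y - Gref' z y‖ ≤ δ * Real.exp (-c * d z y))
    (hVα : ∀ α y, ∑ z, ‖V α y z‖ ≤ v) (hVj : ∀ y, ∑ z, ‖Vj y z‖ ≤ v) (hVρ : ∀ y z, Vj y z ≠ 0 → d y z ≤ ρ)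
    (hVloc : ∀ α y z, Core α y → V α y z = Vj y z)
    (hDGr : ∀ b y, ‖(D * Gref) b y‖ ≤ C' * Real.exp (-c * d (src b) y))
    (hDL : ∀ α b y, Core α (src b) → Core α (tgt b) → ‖(D * G α) b y - (D * Gref) b y‖ ≤ δ' * Real.exp (-c * d (src b) y))
    (b : κ) :
    ∑ x₂, ‖(D * ((Matrix.of fun x₁ x₂ => Z x₁ x₂ * ∑ α, Λ α x₁ x₂ * (G α * V α * G' α) x₁ x₂)
        - Matrix.of fun x₁ x₂ => Z x₁ x₂ * (Gref * Vj * Gref') x₁ x₂)) b x₂‖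
      ≤ Λ₀ * (K ^ 2 * v * (C * δ' + C' * δ + 4 * C * C' * Real.exp (-(c / 2) * (R₂ - 1 - ρ))))
        + s * (C * K ^ 2 * v * (2 * δ + 4 * C * Real.exp (-(c / 2) * (R₂ - 1 - ρ)))) := by
  set B' := K ^ 2 * v * (C * δ' + C' * δ + 4 * C * C' * Real.exp (-(c / 2) * (R₂ - 1 - ρ))) with hB'
  set BF := C * K ^ 2 * v * (2 * δ + 4 * C * Real.exp (-(c / 2) * (R₂ - 1 - ρ))) with hBF
  have hK₀ : 0 ≤ K := (Finset.sum_nonneg fun y _ => (Real.exp_pos _).le).trans (hK (src b))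
  have hB'0 : 0 ≤ B' := by positivity
  have hBF0 : 0 ≤ BF := by positivity
  have hR₂' : 0 ≤ R₂ - 1 := by linarith
  -- entries of `T − T₃`
  have hTT3 : ∀ x₁ x₂, ((Matrix.of fun x₁ x₂ => Z x₁ x₂ * ∑ α, Λ α x₁ x₂ * (G α * V α * G' α) x₁ x₂)
      - Matrix.of fun x₁ x₂ => Z x₁ x₂ * (Gref * Vj * Gref') x₁ x₂) x₁ x₂
      = ∑ α, (Z x₁ x₂ * Λ α x₁ x₂) * (G α * V α * G' α - Gref * Vj * Gref') x₁ x₂ := by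
    intro x₁ x₂
    have h1 : Z x₁ x₂ * (Gref * Vj * Gref') x₁ x₂ = ∑ α, Z x₁ x₂ * Λ α x₁ x₂ * (Gref * Vj * Gref') x₁ x₂ := by
      rw [← Finset.sum_mul, ← Finset.mul_sum, hΛ1 x₁ x₂, mul_one]
    rw [Matrix.sub_apply, Matrix.of_apply, Matrix.of_apply, Finset.mul_sum, h1, ← Finset.sum_sub_distrib]
    refine Finset.sum_congr rfl fun α _ => ?_
    rw [Matrix.sub_apply]
    ring
  -- the product rule, cube by cube
  have hentry : ∀ x₂, (D * ((Matrix.of fun x₁ x₂ => Z x₁ x₂ * ∑ α, Λ α x₁ x₂ * (G α * V α * G' α) x₁ x₂)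
      - Matrix.of fun x₁ x₂ => Z x₁ x₂ * (Gref * Vj * Gref') x₁ x₂)) b x₂
      = ∑ α, ((Z (src b) x₂ * Λ α (src b) x₂) * (D * (G α * V α * G' α - Gref * Vj * Gref')) b x₂
          + cD * u b * (Z (tgt b) x₂ * Λ α (tgt b) x₂ - Z (src b) x₂ * Λ α (src b) x₂)
            * (G α * V α * G' α - Gref * Vj * Gref') (tgt b) x₂) := by
    intro x₂
    rw [hD, hTT3, hTT3, Finset.mul_sum, ← Finset.sum_sub_distrib, Finset.mul_sum]
    refine Finset.sum_congr rfl fun α _ => ?_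
    rw [hD]
    ring
  -- smoothness with the phase
  have hw : ∀ α x₂, ‖cD * u b * (Z (tgt b) x₂ * Λ α (tgt b) x₂ - Z (src b) x₂ * Λ α (src b) x₂)‖ ≤ ν α b := by
    intro α x₂
    calc ‖cD * u b * (Z (tgt b) x₂ * Λ α (tgt b) x₂ - Z (src b) x₂ * Λ α (src b) x₂)‖
        = ‖u b‖ * ‖cD * (Z (tgt b) x₂ * Λ α (tgt b) x₂ - Z (src b) x₂ * Λ α (src b) x₂)‖ := by
          simp only [norm_mul]; ring
      _ ≤ 1 * ν α b := mul_le_mul (hu b) (hνW α b x₂) (norm_nonneg _) zero_le_one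
      _ = ν α b := one_mul _
  -- per cube, the derivative on the kernel
  have hA : ∀ α, ∑ x₂, ‖(Z (src b) x₂ * Λ α (src b) x₂) * (D * (G α * V α * G' α - Gref * Vj * Gref')) b x₂‖
      ≤ μ α (src b) * B' := by
    intro α
    by_cases hex : ∃ x₂, Z (src b) x₂ * Λ α (src b) x₂ ≠ 0
    · obtain ⟨x₂', h0⟩ := hex
      have hball : ∀ z, d (src b) z ≤ R₂ → Core α z := hcore α _ x₂' h0
      have hCs : Core α (src b) := hball _ (by rw [hdd]; linarith)
      have hCt : Core α (tgt b) := hball _ (by linarith [hadj b])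
      have hDP : D * (G α * V α * G' α - Gref * Vj * Gref') = D * G α * V α * G' α - D * Gref * Vj * Gref' := by
        simp only [Matrix.mul_sub, Matrix.mul_assoc]
      have hrow : ∑ x₂, ‖(D * (G α * V α * G' α - Gref * Vj * Gref')) b x₂‖ ≤ B' := by
        rw [hDP]
        exact rowSum_changeSet_rect_le hc hC hC' hδ hδ' hv hρ hd htri hK (hG' α) hGr' (hLG' α) (hVα α) hVj hVρ (hVloc α)
          (fun y => hDGr b y) (fun y => hDL α b y hCs hCt) (fun z (hz : d (src b) z ≤ R₂ - 1) => hball z (by linarith))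
      calc ∑ x₂, ‖(Z (src b) x₂ * Λ α (src b) x₂) * (D * (G α * V α * G' α - Gref * Vj * Gref')) b x₂‖
          ≤ ∑ x₂, μ α (src b) * ‖(D * (G α * V α * G' α - Gref * Vj * Gref')) b x₂‖ :=
            Finset.sum_le_sum fun x₂ _ => by
              rw [norm_mul]; exact mul_le_mul_of_nonneg_right (hΛμ α _ x₂) (norm_nonneg _)
        _ = μ α (src b) * ∑ x₂, ‖(D * (G α * V α * G' α - Gref * Vj * Gref')) b x₂‖ := by rw [Finset.mul_sum]
        _ ≤ μ α (src b) * B' := mul_le_mul_of_nonneg_left hrow (hμ0 α _)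
    · push Not at hex
      calc ∑ x₂, ‖(Z (src b) x₂ * Λ α (src b) x₂) * (D * (G α * V α * G' α - Gref * Vj * Gref')) b x₂‖ = 0 :=
            Finset.sum_eq_zero fun x₂ _ => by rw [hex x₂, zero_mul, norm_zero]
        _ ≤ μ α (src b) * B' := mul_nonneg (hμ0 α _) hB'0
  -- per cube, the derivative on the weight
  have hB : ∀ α, ∑ x₂, ‖cD * u b * (Z (tgt b) x₂ * Λ α (tgt b) x₂ - Z (src b) x₂ * Λ α (src b) x₂)
      * (G α * V α * G' α - Gref * Vj * Gref') (tgt b) x₂‖ ≤ ν α b * BF := by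
    intro α
    by_cases hex : ∃ x₂, Z (tgt b) x₂ * Λ α (tgt b) x₂ - Z (src b) x₂ * Λ α (src b) x₂ ≠ 0
    · obtain ⟨x₂', hne⟩ := hex
      have hballT : ∀ z, d (tgt b) z ≤ R₂ - 1 → Core α z := by
        by_cases h1 : Z (tgt b) x₂' * Λ α (tgt b) x₂' = 0
        · have h0 : Z (src b) x₂' * Λ α (src b) x₂' ≠ 0 := fun h => hne (by rw [h1, h, sub_self])
          exact fun z hz => hcore α _ x₂' h0 z (by linarith [htri (src b) (tgt b) z, hadj b])
        · exact fun z hz => hcore α _ x₂' h1 z (by linarith)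
      have hrow : ∑ x₂, ‖(G α * V α * G' α - Gref * Vj * Gref') (tgt b) x₂‖ ≤ BF :=
        rowSum_changeSet_le hc hC hδ hv hρ hR₂' hd hdd htri hK (hG' α) hGr hGr' (hLG α) (hLG' α) (hVα α) hVj hVρ
          (hVloc α) hballT
      calc ∑ x₂, ‖cD * u b * (Z (tgt b) x₂ * Λ α (tgt b) x₂ - Z (src b) x₂ * Λ α (src b) x₂)
            * (G α * V α * G' α - Gref * Vj * Gref') (tgt b) x₂‖
          ≤ ∑ x₂, ν α b * ‖(G α * V α * G' α - Gref * Vj * Gref') (tgt b) x₂‖ :=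
            Finset.sum_le_sum fun x₂ _ => by
              rw [norm_mul]; exact mul_le_mul_of_nonneg_right (hw α x₂) (norm_nonneg _)
        _ = ν α b * ∑ x₂, ‖(G α * V α * G' α - Gref * Vj * Gref') (tgt b) x₂‖ := by rw [Finset.mul_sum]
        _ ≤ ν α b * BF := mul_le_mul_of_nonneg_left hrow (hν0 α b)
    · push Not at hex
      calc ∑ x₂, ‖cD * u b * (Z (tgt b) x₂ * Λ α (tgt b) x₂ - Z (src b) x₂ * Λ α (src b) x₂)
            * (G α * V α * G' α - Gref * Vj * Gref') (tgt b) x₂‖ = 0 :=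
            Finset.sum_eq_zero fun x₂ _ => by rw [hex x₂, mul_zero, zero_mul, norm_zero]
        _ ≤ ν α b * BF := mul_nonneg (hν0 α b) hBF0
  calc ∑ x₂, ‖(D * ((Matrix.of fun x₁ x₂ => Z x₁ x₂ * ∑ α, Λ α x₁ x₂ * (G α * V α * G' α) x₁ x₂)
          - Matrix.of fun x₁ x₂ => Z x₁ x₂ * (Gref * Vj * Gref') x₁ x₂)) b x₂‖
      = ∑ x₂, ‖∑ α, ((Z (src b) x₂ * Λ α (src b) x₂) * (D * (G α * V α * G' α - Gref * Vj * Gref')) b x₂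
          + cD * u b * (Z (tgt b) x₂ * Λ α (tgt b) x₂ - Z (src b) x₂ * Λ α (src b) x₂)
            * (G α * V α * G' α - Gref * Vj * Gref') (tgt b) x₂)‖ := by
        simp_rw [hentry]
    _ ≤ ∑ x₂, ∑ α, (‖(Z (src b) x₂ * Λ α (src b) x₂) * (D * (G α * V α * G' α - Gref * Vj * Gref')) b x₂‖
          + ‖cD * u b * (Z (tgt b) x₂ * Λ α (tgt b) x₂ - Z (src b) x₂ * Λ α (src b) x₂)
            * (G α * V α * G' α - Gref * Vj * Gref') (tgt b) x₂‖) :=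
        Finset.sum_le_sum fun x₂ _ => (norm_sum_le _ _).trans (Finset.sum_le_sum fun α _ => norm_add_le _ _)
    _ = ∑ α, (∑ x₂, ‖(Z (src b) x₂ * Λ α (src b) x₂) * (D * (G α * V α * G' α - Gref * Vj * Gref')) b x₂‖
          + ∑ x₂, ‖cD * u b * (Z (tgt b) x₂ * Λ α (tgt b) x₂ - Z (src b) x₂ * Λ α (src b) x₂)
            * (G α * V α * G' α - Gref * Vj * Gref') (tgt b) x₂‖) := by
        rw [Finset.sum_comm]
        simp_rw [Finset.sum_add_distrib]
    _ ≤ ∑ α, (μ α (src b) * B' + ν α b * BF) := Finset.sum_le_sum fun α _ => add_le_add (hA α) (hB α)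
    _ = (∑ α, μ α (src b)) * B' + (∑ α, ν α b) * BF := by
        rw [Finset.sum_add_distrib, Finset.sum_mul, Finset.sum_mul]
    _ ≤ Λ₀ * B' + s * BF :=
        add_le_add (mul_le_mul_of_nonneg_right (hμ _) hB'0) (mul_le_mul_of_nonneg_right (hν b) hBF0)

/-- **`D(T₃ − (ζ″G_ref)V_j(ζ″G′_ref))`, rows** — the derivative of the *"changing the tails"* piece: the kernel part
(`rowSum_tails_rect_le` for the row `(DG_ref)(b,·)`, threshold `R₁ − 1`) plus the cutoff part (`rowSum_tailsDelta_le`): rows `≤ 2C′CK²vE₁ +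
2s_ζC²K²vE₁`, `E₁ = e^{−(c/2)(R₁−1−ρ)}`. [cite: BalabanImbrieJaffe1988, (5.6.12) p.287] -/
theorem rowSum_D_T3subS2_le {d : σ → σ → ℝ} {c C C' K v R₁ ρ sZ : ℝ} (hc : 0 ≤ c) (hC : 0 ≤ C) (hC' : 0 ≤ C')
    (hv : 0 ≤ v) (hρ : 0 ≤ ρ) (hsZ0 : 0 ≤ sZ) (hd : ∀ x y, 0 ≤ d x y) (htri : ∀ x y z, d x z ≤ d x y + d y z)
    (hK : ∀ x, ∑ y, Real.exp (-(c / 2) * d x y) ≤ K)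
    {Z : σ → σ → ℂ} (hZ1 : ∀ x y, ‖Z x y‖ ≤ 1) (hZR₁ : ∀ x y, d x y ≤ R₁ → Z x y = 1)
    {tgt src : κ → σ} (hadj : ∀ b, d (src b) (tgt b) ≤ 1)
    {D : Matrix κ σ ℂ} {cD : ℂ} {u : κ → ℂ}
    (hD : ∀ (X : Matrix σ σ ℂ) (b : κ) (y : σ), (D * X) b y = cD * (u b * X (tgt b) y - X (src b) y))
    (hu : ∀ b, ‖u b‖ ≤ 1) (hsZ : ∀ b y, ‖cD * (Z (tgt b) y - Z (src b) y)‖ ≤ sZ)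
    {Gref Vj Gref' : Matrix σ σ ℂ}
    (hGr : ∀ x y, ‖Gref x y‖ ≤ C * Real.exp (-c * d x y)) (hGr' : ∀ x y, ‖Gref' x y‖ ≤ C * Real.exp (-c * d x y))
    (hVj : ∀ y, ∑ z, ‖Vj y z‖ ≤ v) (hVρ : ∀ y z, Vj y z ≠ 0 → d y z ≤ ρ)
    (hDGr : ∀ b y, ‖(D * Gref) b y‖ ≤ C' * Real.exp (-c * d (src b) y)) (b : κ) :
    ∑ x₂, ‖(D * ((Matrix.of fun x₁ x₂ => Z x₁ x₂ * (Gref * Vj * Gref') x₁ x₂)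
        - (Matrix.of fun x y => Z x y * Gref x y) * Vj * Matrix.of fun x y => Z x y * Gref' x y)) b x₂‖
      ≤ 2 * C' * C * K ^ 2 * v * Real.exp (-(c / 2) * (R₁ - 1 - ρ))
        + 2 * sZ * C ^ 2 * K ^ 2 * v * Real.exp (-(c / 2) * (R₁ - 1 - ρ)) := by
  have h1 := deriv_weighted hD Z (Gref * Vj * Gref')
  have h2 := deriv_weighted hD Z Gref
  have h3 : D * (Gref * Vj * Gref') = D * Gref * Vj * Gref' := by simp only [Matrix.mul_assoc]
  have h4 : D * ((Matrix.of fun x y => Z x y * Gref x y) * Vj * Matrix.of fun x y => Z x y * Gref' x y)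
      = (D * Matrix.of fun x y => Z x y * Gref x y) * Vj * Matrix.of fun x y => Z x y * Gref' x y := by
    simp only [Matrix.mul_assoc]
  have hentry : ∀ x₂, (D * ((Matrix.of fun x₁ x₂ => Z x₁ x₂ * (Gref * Vj * Gref') x₁ x₂)
      - (Matrix.of fun x y => Z x y * Gref x y) * Vj * Matrix.of fun x y => Z x y * Gref' x y)) b x₂
      = (Z (src b) x₂ * (D * Gref * Vj * Gref') b x₂
          - ((Matrix.of fun b' y => Z (src b') y * (D * Gref) b' y) * Vj * Matrix.of fun x y => Z x y * Gref' x y) b x₂)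
        + (cD * u b * (Z (tgt b) x₂ - Z (src b) x₂) * (Gref * Vj * Gref') (tgt b) x₂
          - ((Matrix.of fun b' y => cD * u b' * (Z (tgt b') y - Z (src b') y) * Gref (tgt b') y) * Vj
              * Matrix.of fun x y => Z x y * Gref' x y) b x₂) := by
    intro x₂
    rw [Matrix.mul_sub, Matrix.sub_apply, h1, Matrix.add_apply, Matrix.of_apply, Matrix.of_apply, h3, h4, h2, Matrix.add_mul,
      Matrix.add_mul, Matrix.add_apply]
    ring
  have hZR₁' : ∀ x y, d x y ≤ R₁ - 1 → Z x y = 1 := fun x y h => hZR₁ x y (by linarith)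
  have hT1 := rowSum_tails_rect_le hc hC hC' hv hρ hd htri hK hZ1 hZR₁' src (A := D * Gref) hDGr hGr' hVj hVρ b
  have hT2 := rowSum_tailsDelta_le hc hC hv hρ hsZ0 hd htri hK hZ1 hZR₁ hadj hu hsZ hGr hGr' hVj hVρ b
  calc ∑ x₂, ‖(D * ((Matrix.of fun x₁ x₂ => Z x₁ x₂ * (Gref * Vj * Gref') x₁ x₂)
          - (Matrix.of fun x y => Z x y * Gref x y) * Vj * Matrix.of fun x y => Z x y * Gref' x y)) b x₂‖
      ≤ ∑ x₂, (‖Z (src b) x₂ * (D * Gref * Vj * Gref') b x₂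
          - ((Matrix.of fun b' y => Z (src b') y * (D * Gref) b' y) * Vj * Matrix.of fun x y => Z x y * Gref' x y) b x₂‖
        + ‖cD * u b * (Z (tgt b) x₂ - Z (src b) x₂) * (Gref * Vj * Gref') (tgt b) x₂
          - ((Matrix.of fun b' y => cD * u b' * (Z (tgt b') y - Z (src b') y) * Gref (tgt b') y) * Vj
              * Matrix.of fun x y => Z x y * Gref' x y) b x₂‖) :=
        Finset.sum_le_sum fun x₂ _ => by rw [hentry]; exact norm_add_le _ _
    _ ≤ _ := by rw [Finset.sum_add_distrib]; exact add_le_add hT1 hT2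

/-- kernel: the telescoping under `D`: `D(T − G_{loc}V_jG′_{loc}) = D(T − T₃) + D(T₃ − (ζ″G_ref)V_j(ζ″G′_ref)) + D(ζ″G_ref)V_j(ζ″G′_ref −
G′_{loc}) + D(ζ″G_ref − G_{loc})V_jG′_{loc}`. [folklore] -/
private theorem split4D (D : Matrix κ σ ℂ) (T T3 ZG ZG' Vj gL gL' : Matrix σ σ ℂ) :
    D * (T - gL * Vj * gL') = D * (T - T3) + D * (T3 - ZG * Vj * ZG') + D * ZG * Vj * (ZG' - gL') + D * (ZG - gL) * Vj * gL' := by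
  simp only [Matrix.mul_sub, Matrix.sub_mul, Matrix.mul_assoc]
  abel

/-- **`Dw′₆` is small** — p. 287, *"w′₆, a small … local kernel with small covariant derivatives"*, PROVED for `w′₆ = BIJ88Eq5612W6.w6prime
ζ″ λ G V G′ V_j` and a two-point covariant derivative `D` (`(DX)(b,·) = c_D(u_bX(b₊,·) − X(b₋,·))`, `|u_b| ≤ 1`, `d(b₋,b₊) ≤ 1`) in the
max-row-sum operator norm from the inputs of `BIJ88W6PrimeSmall287.norm_w6prime_le` plus: (2.30) for `DG_ref`, `‖(DG_ref)(b,y)‖ ≤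
C′e^{−c d(b₋,y)}`; (2.31) for `DG`, `‖(DG_α − DG_ref)(b,y)‖ ≤ δ′e^{−c d(b₋,y)}` for `b₋, b₊` in the core of `□_α` (p. 263: *"Bounds
analogous to (2.30), (2.31) hold for covariant derivatives"*); the smoothness across a bond `c_D|ζ″(b₊,·) − ζ″(b₋,·)| ≤ s_ζ`, `Σ_α c_D|ζ″λ_α
(b₊,·) − ζ″λ_α(b₋,·)| ≤ s`; `R₂ ≥ 1`.  Then `‖Dw′₆‖ ≤ K²v·{Λ₀(Cδ′ + C′δ + 4CC′E₂) + sC(2δ + 4CE₂) + 2C(C′ + s_ζC)E₁ + Λ₀δ(C′ + s_ζC)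
+ Λ₀C(Λ₀δ′ + sδ)}`, `E₂ = e^{−(c/2)(R₂−1−ρ)}`, `E₁ = e^{−(c/2)(R₁−1−ρ)}`. [cite: BalabanImbrieJaffe1988, (5.6.12) p.287] -/
theorem norm_D_w6prime_le [Fintype κ] {d : σ → σ → ℝ} {Core : ι → σ → Prop} {c C C' δ δ' K v Λ₀ s sZ R₁ R₂ ρ : ℝ}
    (hc : 0 ≤ c) (hC : 0 ≤ C) (hC' : 0 ≤ C') (hδ : 0 ≤ δ) (hδ' : 0 ≤ δ') (hK₀ : 0 ≤ K) (hv : 0 ≤ v) (hΛ₀ : 0 ≤ Λ₀)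
    (hs0 : 0 ≤ s) (hsZ0 : 0 ≤ sZ) (hρ : 0 ≤ ρ) (hR₂ : 1 ≤ R₂)
    (hd : ∀ x y, 0 ≤ d x y) (hdd : ∀ x, d x x = 0) (htri : ∀ x y z, d x z ≤ d x y + d y z)
    (hK : ∀ x, ∑ y, Real.exp (-(c / 2) * d x y) ≤ K)
    {Z : σ → σ → ℂ} (hZ1 : ∀ x y, ‖Z x y‖ ≤ 1) (hZR₁ : ∀ x y, d x y ≤ R₁ → Z x y = 1)
    {Λ : ι → σ → σ → ℂ} {μ : ι → σ → ℝ} (hμ0 : ∀ α x, 0 ≤ μ α x)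
    (hΛμ : ∀ α x y, ‖Z x y * Λ α x y‖ ≤ μ α x) (hμ : ∀ x, ∑ α, μ α x ≤ Λ₀) (hΛ1 : ∀ x y, ∑ α, Λ α x y = 1)
    (hcore : ∀ α x y, Z x y * Λ α x y ≠ 0 → ∀ z, d x z ≤ R₂ → Core α z)
    {tgt src : κ → σ} (hadj : ∀ b, d (src b) (tgt b) ≤ 1)
    {D : Matrix κ σ ℂ} {cD : ℂ} {u : κ → ℂ}
    (hD : ∀ (X : Matrix σ σ ℂ) (b : κ) (y : σ), (D * X) b y = cD * (u b * X (tgt b) y - X (src b) y))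
    (hu : ∀ b, ‖u b‖ ≤ 1) (hsZ : ∀ b y, ‖cD * (Z (tgt b) y - Z (src b) y)‖ ≤ sZ)
    {ν : ι → κ → ℝ} (hν0 : ∀ α b, 0 ≤ ν α b)
    (hνW : ∀ α b y, ‖cD * (Z (tgt b) y * Λ α (tgt b) y - Z (src b) y * Λ α (src b) y)‖ ≤ ν α b)
    (hν : ∀ b, ∑ α, ν α b ≤ s)
    {G V G' : ι → Matrix σ σ ℂ} {Gref Vj Gref' : Matrix σ σ ℂ}
    (hG' : ∀ α x y, ‖G' α x y‖ ≤ C * Real.exp (-c * d x y)) (hGr : ∀ x y, ‖Gref x y‖ ≤ C * Real.exp (-c * d x y))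
    (hGr' : ∀ x y, ‖Gref' x y‖ ≤ C * Real.exp (-c * d x y))
    (hLG : ∀ α z y, Core α z → ‖G α z y - Gref z y‖ ≤ δ * Real.exp (-c * d z y))
    (hLG' : ∀ α z y, Core α z → ‖G' α z y - Gref' z y‖ ≤ δ * Real.exp (-c * d z y))
    (hVα : ∀ α y, ∑ z, ‖V α y z‖ ≤ v) (hVj : ∀ y, ∑ z, ‖Vj y z‖ ≤ v) (hVρ : ∀ y z, Vj y z ≠ 0 → d y z ≤ ρ)
    (hVloc : ∀ α y z, Core α y → V α y z = Vj y z)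
    (hDGr : ∀ b y, ‖(D * Gref) b y‖ ≤ C' * Real.exp (-c * d (src b) y))
    (hDL : ∀ α b y, Core α (src b) → Core α (tgt b) → ‖(D * G α) b y - (D * Gref) b y‖ ≤ δ' * Real.exp (-c * d (src b) y)) :
    ‖D * w6prime Z Λ G V G' Vj‖
      ≤ K ^ 2 * v * (Λ₀ * (C * δ' + C' * δ + 4 * C * C' * Real.exp (-(c / 2) * (R₂ - 1 - ρ)))
          + s * C * (2 * δ + 4 * C * Real.exp (-(c / 2) * (R₂ - 1 - ρ)))
          + 2 * C * (C' + sZ * C) * Real.exp (-(c / 2) * (R₁ - 1 - ρ))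
          + Λ₀ * δ * (C' + sZ * C) + Λ₀ * C * (Λ₀ * δ' + s * δ)) := by
  set T : Matrix σ σ ℂ := Matrix.of fun x₁ x₂ => Z x₁ x₂ * ∑ α, Λ α x₁ x₂ * (G α * V α * G' α) x₁ x₂ with hT
  set T3 : Matrix σ σ ℂ := Matrix.of fun x₁ x₂ => Z x₁ x₂ * (Gref * Vj * Gref') x₁ x₂ with hT3
  set ZG : Matrix σ σ ℂ := Matrix.of fun x y => Z x y * Gref x y with hZG
  set ZG' : Matrix σ σ ℂ := Matrix.of fun x y => Z x y * Gref' x y with hZG'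
  have hR₂0 : 0 ≤ R₂ := by linarith
  have hw : w6prime Z Λ G V G' Vj = T - gLoc Z Λ G * Vj * gLoc Z Λ G' := rfl
  -- the four pieces
  have hP1 : ‖D * (T - T3)‖ ≤ Λ₀ * (K ^ 2 * v * (C * δ' + C' * δ + 4 * C * C' * Real.exp (-(c / 2) * (R₂ - 1 - ρ))))
      + s * (C * K ^ 2 * v * (2 * δ + 4 * C * Real.exp (-(c / 2) * (R₂ - 1 - ρ)))) := by
    refine norm_le_of_rowSums _ (by positivity) fun b => ?_
    rw [hT, hT3]
    exact rowSum_D_TsubT3_le hc hC hC' hδ hδ' hv hρ hR₂ hd hdd htri hK hμ0 hΛμ hμ hΛ1 hcore hadj hD hu hν0 hνW hν hG' hGr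
      hGr' hLG hLG' hVα hVj hVρ hVloc hDGr hDL b
  have hP2 : ‖D * (T3 - ZG * Vj * ZG')‖ ≤ 2 * C' * C * K ^ 2 * v * Real.exp (-(c / 2) * (R₁ - 1 - ρ))
      + 2 * sZ * C ^ 2 * K ^ 2 * v * Real.exp (-(c / 2) * (R₁ - 1 - ρ)) := by
    refine norm_le_of_rowSums _ (by positivity) fun b => ?_
    rw [hT3, hZG, hZG']
    exact rowSum_D_T3subS2_le hc hC hC' hv hρ hsZ0 hd htri hK hZ1 hZR₁ hadj hD hu hsZ hGr hGr' hVj hVρ hDGr b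
  have hDZGn : ‖D * ZG‖ ≤ (C' + sZ * C) * K := by
    refine norm_le_of_rowSums _ (by positivity) fun b => ?_
    rw [hZG]
    exact rowSum_D_ZG_le hc hC' hsZ0 hd hK hZ1 hD hu hsZ hGr hDGr b
  have hVjn : ‖Vj‖ ≤ v := norm_le_of_rowSums _ hv hVj
  have hgL' : ‖gLoc Z Λ G'‖ ≤ Λ₀ * (C * K) :=
    norm_le_of_rowSums _ (by positivity) (rowSum_gLoc_le hc hC hd hK hμ0 hΛμ hμ hG')
  have hdG' : ‖ZG' - gLoc Z Λ G'‖ ≤ Λ₀ * (δ * K) := by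
    rw [norm_sub_rev]
    refine norm_le_of_rowSums _ (by positivity) fun x => ?_
    simp only [hZG', Matrix.sub_apply, Matrix.of_apply]
    exact rowSum_gLoc_sub_le hc hδ hR₂0 hd hdd hK hμ0 hΛμ hμ hΛ1 hcore hLG' x
  have hDdG : ‖D * (ZG - gLoc Z Λ G)‖ ≤ (Λ₀ * δ' + s * δ) * K := by
    refine norm_le_of_rowSums _ (by positivity) fun b => ?_
    rw [hZG]
    exact rowSum_D_gLoc_sub_le hc hδ hδ' hR₂ hd hdd hK hμ0 hΛμ hμ hΛ1 hcore hadj hD hu hν0 hνW hν hLG hDL b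
  have hP3 : ‖D * ZG * Vj * (ZG' - gLoc Z Λ G')‖ ≤ (C' + sZ * C) * K * v * (Λ₀ * (δ * K)) :=
    calc ‖D * ZG * Vj * (ZG' - gLoc Z Λ G')‖ ≤ ‖D * ZG‖ * ‖Vj‖ * ‖ZG' - gLoc Z Λ G'‖ :=
          (Matrix.linfty_opNorm_mul _ _).trans (mul_le_mul_of_nonneg_right (Matrix.linfty_opNorm_mul _ _) (norm_nonneg _))
      _ ≤ (C' + sZ * C) * K * v * (Λ₀ * (δ * K)) := by gcongr
  have hP4 : ‖D * (ZG - gLoc Z Λ G) * Vj * gLoc Z Λ G'‖ ≤ (Λ₀ * δ' + s * δ) * K * v * (Λ₀ * (C * K)) :=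
    calc ‖D * (ZG - gLoc Z Λ G) * Vj * gLoc Z Λ G'‖ ≤ ‖D * (ZG - gLoc Z Λ G)‖ * ‖Vj‖ * ‖gLoc Z Λ G'‖ :=
          (Matrix.linfty_opNorm_mul _ _).trans (mul_le_mul_of_nonneg_right (Matrix.linfty_opNorm_mul _ _) (norm_nonneg _))
      _ ≤ (Λ₀ * δ' + s * δ) * K * v * (Λ₀ * (C * K)) := by gcongr
  calc ‖D * w6prime Z Λ G V G' Vj‖
      = ‖D * (T - T3) + D * (T3 - ZG * Vj * ZG') + D * ZG * Vj * (ZG' - gLoc Z Λ G') + D * (ZG - gLoc Z Λ G) * Vj * gLoc Z Λ G'‖ := by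
        rw [hw, split4D D T T3 ZG ZG']
    _ ≤ ‖D * (T - T3)‖ + ‖D * (T3 - ZG * Vj * ZG')‖ + ‖D * ZG * Vj * (ZG' - gLoc Z Λ G')‖
          + ‖D * (ZG - gLoc Z Λ G) * Vj * gLoc Z Λ G'‖ :=
        (norm_add_le _ _).trans (add_le_add norm_add₃_le le_rfl)
    _ ≤ (Λ₀ * (K ^ 2 * v * (C * δ' + C' * δ + 4 * C * C' * Real.exp (-(c / 2) * (R₂ - 1 - ρ))))
            + s * (C * K ^ 2 * v * (2 * δ + 4 * C * Real.exp (-(c / 2) * (R₂ - 1 - ρ)))))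
          + (2 * C' * C * K ^ 2 * v * Real.exp (-(c / 2) * (R₁ - 1 - ρ))
            + 2 * sZ * C ^ 2 * K ^ 2 * v * Real.exp (-(c / 2) * (R₁ - 1 - ρ)))
          + (C' + sZ * C) * K * v * (Λ₀ * (δ * K)) + (Λ₀ * δ' + s * δ) * K * v * (Λ₀ * (C * K)) :=
        add_le_add (add_le_add (add_le_add hP1 hP2) hP3) hP4
    _ = _ := by ring

/-- **the printed smallness of `Dw′₆`**: if `δ, δ′ ≤ e^{−c₀r}` ((2.31) and its derivative version: `e^{−cr(e_k)}`) and the thresholds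
satisfy `(c/2)(R₂−1−ρ) ≥ c₀r`, `(c/2)(R₁−1−ρ) ≥ c₀r`, the bound of `norm_D_w6prime_le` is `≤ K²v·{Λ₀(C + C′ + 4CC′) + sC(2 + 4C) + 2C(C′ +
s_ζC) + Λ₀(C′ + s_ζC) + Λ₀C(Λ₀ + s)}·e^{−c₀r}`. [cite: BalabanImbrieJaffe1988, (5.6.12) p.287] -/
theorem boundD_le_exp {c C C' δ δ' K v Λ₀ s sZ R₁ R₂ ρ c₀ r : ℝ} (hC : 0 ≤ C) (hC' : 0 ≤ C') (hv : 0 ≤ v) (hΛ₀ : 0 ≤ Λ₀)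
    (hs0 : 0 ≤ s) (hsZ0 : 0 ≤ sZ)
    (hδ : δ ≤ Real.exp (-c₀ * r)) (hδ' : δ' ≤ Real.exp (-c₀ * r))
    (h2 : c₀ * r ≤ (c / 2) * (R₂ - 1 - ρ)) (h1 : c₀ * r ≤ (c / 2) * (R₁ - 1 - ρ)) :
    K ^ 2 * v * (Λ₀ * (C * δ' + C' * δ + 4 * C * C' * Real.exp (-(c / 2) * (R₂ - 1 - ρ)))
          + s * C * (2 * δ + 4 * C * Real.exp (-(c / 2) * (R₂ - 1 - ρ)))
          + 2 * C * (C' + sZ * C) * Real.exp (-(c / 2) * (R₁ - 1 - ρ))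
          + Λ₀ * δ * (C' + sZ * C) + Λ₀ * C * (Λ₀ * δ' + s * δ))
      ≤ K ^ 2 * v * (Λ₀ * (C + C' + 4 * C * C') + s * C * (2 + 4 * C) + 2 * C * (C' + sZ * C) + Λ₀ * (C' + sZ * C)
          + Λ₀ * C * (Λ₀ + s)) * Real.exp (-c₀ * r) := by
  have e2 : Real.exp (-(c / 2) * (R₂ - 1 - ρ)) ≤ Real.exp (-c₀ * r) := Real.exp_le_exp.mpr (by linarith)
  have e1 : Real.exp (-(c / 2) * (R₁ - 1 - ρ)) ≤ Real.exp (-c₀ * r) := Real.exp_le_exp.mpr (by linarith)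
  calc K ^ 2 * v * (Λ₀ * (C * δ' + C' * δ + 4 * C * C' * Real.exp (-(c / 2) * (R₂ - 1 - ρ)))
          + s * C * (2 * δ + 4 * C * Real.exp (-(c / 2) * (R₂ - 1 - ρ)))
          + 2 * C * (C' + sZ * C) * Real.exp (-(c / 2) * (R₁ - 1 - ρ))
          + Λ₀ * δ * (C' + sZ * C) + Λ₀ * C * (Λ₀ * δ' + s * δ))
      ≤ K ^ 2 * v * (Λ₀ * (C * Real.exp (-c₀ * r) + C' * Real.exp (-c₀ * r) + 4 * C * C' * Real.exp (-c₀ * r))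
          + s * C * (2 * Real.exp (-c₀ * r) + 4 * C * Real.exp (-c₀ * r))
          + 2 * C * (C' + sZ * C) * Real.exp (-c₀ * r)
          + Λ₀ * Real.exp (-c₀ * r) * (C' + sZ * C) + Λ₀ * C * (Λ₀ * Real.exp (-c₀ * r) + s * Real.exp (-c₀ * r))) := by
        gcongr
    _ = _ := by ring

end Main

end

end Literature.MathematicalPhysics.QuantumFieldTheory.BalabanImbrieJaffe1984to88.BIJ88W6PrimeDerivSmall287
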